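import Literature.Geometry.Riemannian.HamiltonCurvatureODE
import Literature.Geometry.Riemannian.PinchingEstimatesConstraints
import Mathlib.Analysis.SpecialFunctions.Pow.Real
import Literature.Geometry.Riemannian.ChangGurskyYangWeylBudget
import Literature.Geometry.Riemannian.PinchingCurvatureBound
import Literature.Geometry.Riemannian.ChangGurskyYangRegularity
import Literature.Geometry.Riemannian.RicciFlowMaximal
import Literature.Geometry.Riemannian.RicciFlowMaximalProofs
import Literature.Geometry.Riemannian.RicciFlowSingularTimeHolds
import Literature.Geometry.Riemannian.ChangGurskyYangProofs
import Literature.Geometry.Lorentzian.CoordHamiltonGradientFunction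
import Literature.Geometry.Riemannian.RicciFlowScalarCurvatureEvolution
import Literature.Geometry.Riemannian.CurvatureNormSq
import Literature.Geometry.Riemannian.PerelmanEntropyFormulaManifold
import Literature.Geometry.Riemannian.RicciFlowScalarCurvatureRegularity
import Literature.Geometry.Riemannian.FamilyLaplacianRegularity
import Literature.Geometry.Lorentzian.CoordFamilyRegularity
import Literature.Geometry.Lorentzian.EnergyCurrents
import Literature.Geometry.Riemannian.RicciFlowScalarMaximumPrinciple
import Literature.Geometry.Riemannian.RicciFlowSpatialRicciBounds
import Literature.Geometry.Riemannian.RicciFlowShortTimeProofs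
import Mathlib.Geometry.Manifold.Algebra.LieGroup
import Literature.Geometry.Riemannian.PerelmanEntropyCutoff
import Mathlib.Analysis.SpecialFunctions.Pow.Deriv
import HarnessLib

/-!
# Hamilton's pinched Ricci flow in dimension four, I: block coordinates, finite-time maximal flow, gradient estimates for `R` (re-homed proofs)

**Hamilton's convergence criterion (Hamilton 1986, §5, 5.2) in dimension four — file 1 of 4 of the EXACT discharge of
`Literature.Geometry.Riemannian.hamilton_convergenceCriterion_four` (`HamiltonConvergenceCriterion.lean`).**  Contents: Hamilton's
block coordinates `(A B; ᵗB C)` of the curvature operator and the pinching sets `Z(m, c, K, τ)` (Hamilton 1986, §5 Def. 5.1, §6;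
Margerin 1998, Part I) with the dictionary `tr A + tr C = R`, `|𝒟|² = |W|² + 2|E|²` [Hamilton1986]; the maximal flow from a
pinched metric is finite-time (Hamilton 1982, Thm. 14.1; Topping 2006, Cor. 3.2.4) [Hamilton1982] [Topping2006]; invariance of the
pinching read through the dictionary; and Hamilton's gradient estimates for the scalar curvature — the evolution inequality for
`u = |∇R|²/R + N|E|² − ηR²` (Hamilton 1982, §11, Lemmas 11.5–11.9; Huisken 1985, Thm. 4.1 [Huisken1985]), space-time smoothness
of `|∇R|²`, `|Ric|²`, Type-I bounds (§16), the maximum-principle endgame `|∇R|² ≤ ηR³ + C(η)` (Thm. 11.1) and the decay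
`|∇R|² ≤ C (T − t)^{δ−3}` (Lemma 17.4), assembled as `stub_gradientEstimates`.
RE-HOMED into `Literature/` by the Hodge foundations lane (`lit-hodgefound`, seat p20, generation 40): verbatim
DECLARATION-LEVEL ports (the declarations needed, in dependency order; each Part is one Summits module with a neutralised
module docstring) of the theorem-only cone below `Summits/SmoothPoincare4/SmoothPoincare4/Theorems/EntropyRungChangGurskyYangFlowLeafClosed.lean`
(33 modules `EntropyRungMargerinRailsDefs`, `EntropyRungChangGurskyYang{StubInitialFit,StubMaximalFlow,StubInvariantPinching,
StubGradientEstimates*,StubRoundnessRate*,StubCurvatureRatio*,StubLimitRound,StubScaledShi,StubSmoothRoundLimit*,OfBlowupLimit,FlowLeafClosed}`;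
139 declarations in four files `HamiltonPinchedFlowGradientEstimates` → `HamiltonPinchedFlowRoundnessRate` →
`HamiltonPinchedFlowCurvatureDecay` → `HamiltonConvergenceCriterionHolds`), namespace
`Summit.SmoothPoincare4.SmoothPoincare4.Theorems.MargerinRails` re-rooted as `Literature.Geometry.Riemannian.HamiltonPinchedFlow`
(the in-tree `stub_…`/`helper_…` theorem names are kept so that twins have the same short names; they are proved theorems).
Built on the tree's Literature Ricci-flow layer (`Literature/Geometry/Riemannian/RicciFlow*`, `CurvatureNormSq`,
`CurvatureDerivativeNormSq`, `RicciFlowShiEstimates`, `ShiDerivativeMaxPrinciple`, `RicciFlowScalarMaximumPrinciple`,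
`RicciFlowMaximal(Proofs)`, `RicciFlowShortTimeProofs`, `RicciFlowMetricLimit`, `RicciFlowSmoothExtension`, `HamiltonCurvatureODE`,
`HamiltonCurvatureRatio`, `PinchingEstimatesConstraints`, `ChangGurskyYang{Proofs,Regularity,WeylBudget}`, `BonnetMyers`, …) and
`Literature/Geometry/Lorentzian/` (coordinate curvature calculus).  Imports Mathlib/Literature only; no new named fact (D-0026);
every declaration carries the citation of the printed statement it formalises or serves.  The Summits originals stay in place
(transitional duplication).  WHAT THIS IS NOT: nothing here bears on the smooth Poincaré conjecture in dimension four or on any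
summit statement; it is Hamilton's 1982/1986 Ricci-flow analysis on a closed 4-manifold in the tree's vocabulary
(`PseudoRiemannianMetric`, `CovariantDerivative`, `IsRicciFlow` with explicit Levi-Civita witnesses).
-/

noncomputable section

/-!
## Part 1 — port of `Summits/SmoothPoincare4/SmoothPoincare4/Theorems/EntropyRungMargerinRailsDefs.lean` (8 declarations kept)

# Hamilton's block coordinates of the curvature operator: Frobenius norms, `R = tr A + tr C`, `|Rm|²`, Margerin's deviation `|𝒟|²`, Margerin's cone and the pinching sets `Z(m, c, K, τ)`

Declarations of this Part (verbatim port; each keeps its own docstring and citation): `frobSq`, `scal`, `rmNormSq`, `devNormSq`, `margerinCone`, `pinchingSet`, `mem_margerinCone`, `mem_pinchingSet`.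

References: C. Margerin, *A sharp characterization of the smooth 4-sphere in curvature terms*, Comm. Anal. Geom. 6 (1998) 21–65 [Margerin1998]; R. S. Hamilton, *Four-manifolds with positive curvature operator*, J. Differential Geom. 24 (1986) 153–179 [Hamilton1986]; S.-Y. A. Chang, M. J. Gursky, P. C. Yang, *A conformally invariant sphere theorem in four dimensions*, Publ. Math. IHÉS 98 (2003) 105–143 [ChangGurskyYang2003].
-/

section Part1

open _root_.Set
open scoped _root_.Matrix _root_.BigOperators

namespace Literature.Geometry.Riemannian.HamiltonPinchedFlow

open Literature.Geometry.Riemannian Literature.Geometry.Riemannian.HamiltonODE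

/-! ## The `(0,4)`-geometry of block triples -/

/-- Frobenius square norm `Σᵢⱼ Xᵢⱼ²` of a `3 × 3` block. [cite: Hamilton1986, §5, Def. 5.1 (p. 163) and §6 (pp. 165–166); Margerin 1998, Part I, p. 25] -/
def frobSq (X : Matrix (Fin 3) (Fin 3) ℝ) : ℝ := ∑ i, ∑ j, X i j ^ 2

/-- Scalar curvature of a block triple in the tree's normalisation: `R = tr A + tr C`
(unit `S⁴`: `A = C = 2·1`, `R = 12`; unit `S³ × ℝ`: `A = C = 1`, `R = 6`). [cite: Hamilton1986, §6, p. 166] -/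
def scal (p : Blocks) : ℝ := p.1.trace + p.2.2.trace

/-- `|Rm|²` in the `(0,4)`-norm: `‖A‖² + 2‖B‖² + ‖C‖²` (unit `S⁴`: `24 = R²/6`).
[cite: ChangGurskyYang2003, (0.2) and Remark 2] -/
def rmNormSq (p : Blocks) : ℝ := frobSq p.1 + 2 * frobSq p.2.1 + frobSq p.2.2

/-- **Margerin's deviation** `|𝒟|² = |W|² + 2|E|² = |Rm|² − R²/6` — the squared distance of the
block triple to the identity ray `{(λ·1, 0, λ·1)}` in the `(0,4)`-norm (CGY 2003 (0.2): `|Z|²`;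
Margerin 1998, Part I, p. 25). [cite: ChangGurskyYang2003, (0.2)] [cite: Margerin1998, Part I, p. 25] -/
def devNormSq (p : Blocks) : ℝ := rmNormSq p - scal p ^ 2 / 6

/-- **Margerin's closed weak-pinching cone `WP ≤ c`** in Hamilton's block coordinates, ON THE
BIANCHI LOCUS (`A`, `C` symmetric, `tr A = tr C` — load-bearing: off the locus the polynomial
inequality fails),
with `R ≥ 0`: `|𝒟|² ≤ c·R²`. For `c = 1/6` this is the round cone of half-angle `45°` about the
identity ray; `(ℂP², g_FS)` and `S³ × ℝ` lie on its boundary.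
[cite: Margerin1998, Thm. 1 and Part I, p. 25] [cite: ChangGurskyYang2003, (0.2)] -/
def margerinCone (c : ℝ) : Set Blocks :=
  {p | p.1.IsSymm ∧ p.2.2.IsSymm ∧ p.1.trace = p.2.2.trace ∧ 0 ≤ scal p ∧
    devNormSq p ≤ c * scal p ^ 2}

/-- **The `β`-weak-pinching sets** `Z(m, c, K, τ) = margerinCone c ∩ {R ≥ m} ∩ {|𝒟|² ≤ K·R^{2−τ}}`
(`β = 2 − τ`): Margerin's improving pinching `|𝒟|² ≤ K·scal^β` (Prop. 4) inside the cone `WP ≤ c`,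
cut off below by `R ≥ m > 0` so that the sets avoid the apex. Hamilton pinching sets in the sense of
Hamilton 1986, Def. 5.1. [cite: Margerin1998, Part I, Prop. 4 (p. 27)] [cite: Hamilton1986, §5, Def. 5.1 (p. 163)] -/
def pinchingSet (m c K τ : ℝ) : Set Blocks :=
  margerinCone c ∩ {p | m ≤ scal p ∧ devNormSq p ≤ K * scal p ^ (2 - τ)}

/-! ## Unfolding API -/

/-- Membership in Margerin's cone, unfolded. [cite: Hamilton1986, §5, Def. 5.1 (p. 163) and §6 (pp. 165–166); Margerin 1998, Part I, p. 25] -/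
theorem mem_margerinCone {c : ℝ} {p : Blocks} :
    p ∈ margerinCone c ↔ p.1.IsSymm ∧ p.2.2.IsSymm ∧ p.1.trace = p.2.2.trace ∧ 0 ≤ scal p ∧
      devNormSq p ≤ c * scal p ^ 2 := Iff.rfl

/-- Membership in a pinching set, unfolded. [cite: Hamilton1986, §5, Def. 5.1 (p. 163) and §6 (pp. 165–166); Margerin 1998, Part I, p. 25] -/
theorem mem_pinchingSet {m c K τ : ℝ} {p : Blocks} :
    p ∈ pinchingSet m c K τ ↔ p ∈ margerinCone c ∧ m ≤ scal p ∧ devNormSq p ≤ K * scal p ^ (2 - τ) :=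
  Iff.rfl

end Literature.Geometry.Riemannian.HamiltonPinchedFlow

end Part1

/-!
## Part 2 — port of `Summits/SmoothPoincare4/SmoothPoincare4/Theorems/EntropyRungChangGurskyYangStubInitialFit.lean` (6 declarations kept)

# The dictionary weak pinching ↔ Hamilton blocks: `(0,4)`-Pythagoras `Σ Rm² = ‖A‖² + 2‖B‖² + ‖C‖²`, `tr A + tr C = R`, `|𝒟|² = |W|² + 2|E|²`

Declarations of this Part (verbatim port; each keeps its own docstring and citation): `sum_sq_eq_blockArr`, `blockB_eq_blockArr`, `blocks_eq_leviCivita_of_isLeviCivita`, `rmNormSq_blocks_eq_curvNormSqFrame`, `scal_blocks_eq`, `devNormSq_blocks_eq`.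

References: C. Margerin, *A sharp characterization of the smooth 4-sphere in curvature terms*, Comm. Anal. Geom. 6 (1998) 21–65 [Margerin1998]; S.-Y. A. Chang, M. J. Gursky, P. C. Yang, *A conformally invariant sphere theorem in four dimensions*, Publ. Math. IHÉS 98 (2003) 105–143 [ChangGurskyYang2003]; R. S. Hamilton, *Four-manifolds with positive curvature operator*, J. Differential Geom. 24 (1986) 153–179 [Hamilton1986]; R. S. Hamilton, *Four-manifolds with positive isotropic curvature*, Comm. Anal. Geom. 5 (1997) 1–92 [Hamilton1997]; A. L. Besse, *Einstein Manifolds*, Springer 1987 [Besse1987].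
-/

section Part2

open _root_.Set _root_.Function _root_.Module
open scoped _root_.Manifold _root_.ContDiff _root_.Matrix _root_.BigOperators _root_.Topology

namespace Literature.Geometry.Riemannian.HamiltonPinchedFlow

open Literature.Geometry.Riemannian Literature.Geometry.Riemannian.HamiltonODE
open Literature.Geometry.Lorentzian Literature.Geometry.Lorentzian.PseudoRiemannianMetric

/-! ## The `(0,4)`-Pythagoras `Σ Rm² = ‖A‖² + 2‖B‖² + ‖C‖²` on curvature arrays -/

/-- **`Σ_{ijkl} R_{ijkl}² = ‖A‖_F² + 2‖B‖_F² + ‖C‖_F²`** for an array `R` on `Fin 4` antisymmetric in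
each pair and pair-symmetric, where `A`, `B`, `C` are Hamilton's block arrays
(`WeylBlocks.blockArr` on the index tables `sdIdx`, `asdIdx`: `A_{ij} = R(φᵢ, φⱼ)`, `B_{ij} = R(φᵢ, ψⱼ)`,
`C_{ij} = R(ψᵢ, ψⱼ)` with `R(X∧Y, Z∧W) = R_{XYWZ}`): the `(0,4)`-norm is `4×` the Hilbert–Schmidt norm
on `Λ²`, and `φᵢ/√2`, `ψᵢ/√2` is an orthonormal basis of `Λ²` (Chang–Gursky–Yang 2003, Remark 2;
Hamilton 1986, §6). A polynomial identity in the `21` independent components (no Bianchi identity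
needed), verified by normalising the `256`-term sum with `ring`, as
`WeylBlocks.sum_weylArr_sq_eq_blocksNormSq`. [cite: ChangGurskyYang2003, (0.2) and Remark 2] -/
theorem sum_sq_eq_blockArr (R : Fin 4 → Fin 4 → Fin 4 → Fin 4 → ℝ)
    (h12 : ∀ a b c d, R a b c d = -R b a c d) (h34 : ∀ a b c d, R a b c d = -R a b d c)
    (hp : ∀ a b c d, R a b c d = R c d a b) :
    ∑ i, ∑ j, ∑ k, ∑ l, R i j k l ^ 2 =
      (∑ i, ∑ j, WeylBlocks.blockArr WeylBlocks.sdIdx WeylBlocks.sdIdx R i j ^ 2) +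
        2 * (∑ i, ∑ j, WeylBlocks.blockArr WeylBlocks.sdIdx WeylBlocks.asdIdx R i j ^ 2) +
        ∑ i, ∑ j, WeylBlocks.blockArr WeylBlocks.asdIdx WeylBlocks.asdIdx R i j ^ 2 := by
  have hz12 : ∀ a c d, R a a c d = 0 := fun a c d ↦ by have := h12 a a c d; linarith
  have hz34 : ∀ a b c, R a b c c = 0 := fun a b c ↦ by have := h34 a b c c; linarith
  simp only [WeylBlocks.blockArr, Fin.sum_univ_four, Fin.sum_univ_three, Fin.sum_univ_two,
    Fin.isValue, WeylBlocks.sdIdx_0_0, WeylBlocks.sdIdx_0_1, WeylBlocks.sdIdx_1_0,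
    WeylBlocks.sdIdx_1_1, WeylBlocks.sdIdx_2_0, WeylBlocks.sdIdx_2_1, WeylBlocks.asdIdx_0_0,
    WeylBlocks.asdIdx_0_1, WeylBlocks.asdIdx_1_0, WeylBlocks.asdIdx_1_1, WeylBlocks.asdIdx_2_0,
    WeylBlocks.asdIdx_2_1]
  simp only [hz12, hz34, h12 1 0, h12 2 0, h12 2 1, h12 3 0, h12 3 1, h12 3 2,
    fun a b => h34 a b 1 0, fun a b => h34 a b 2 0, fun a b => h34 a b 2 1,
    fun a b => h34 a b 3 0, fun a b => h34 a b 3 1, fun a b => h34 a b 3 2, hp 0 2 0 1,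
    hp 0 3 0 1, hp 0 3 0 2, hp 1 2 0 1, hp 1 2 0 2, hp 1 2 0 3, hp 1 3 0 1, hp 1 3 0 2,
    hp 1 3 0 3, hp 1 3 1 2, hp 2 3 0 1, hp 2 3 0 2, hp 2 3 0 3, hp 2 3 1 2, hp 2 3 1 3]
  ring

/-! ## The dictionary for a metric: blocks of Levi-Civita connections -/

section Dictionary

variable {E : Type*} [NormedAddCommGroup E] [NormedSpace ℝ E] {H : Type*} [TopologicalSpace H]
  {I : ModelWithCorners ℝ E H} {M : Type*} [TopologicalSpace M] [ChartedSpace H M]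
  [IsManifold I ∞ M] {n : ℕ∞ω}
  (g : PseudoRiemannianMetric I n E (TangentSpace I : M → Type _))
  (cov : CovariantDerivative I E (TangentSpace I : M → Type _))

/-- `B_{ij}` is the array block `blockArr sdIdx asdIdx` of the frame components
`R_{abcd} = Rm(e_a, e_b, e_c, e_d)` (companion of `blockA_eq_blockArr`, `blockC_eq_blockArr`).
[cite: Hamilton1997, §1.2, pp. 4–5] -/
theorem blockB_eq_blockArr {x : M} (e : Fin 4 → TangentSpace I x) (i j : Fin 3) :
    g.blockB cov x e i j =
      WeylBlocks.blockArr WeylBlocks.sdIdx WeylBlocks.asdIdx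
        (fun a b c d ↦ g.curvatureForm cov x (e a) (e b) (e c) (e d)) i j := by
  simp only [blockB, Matrix.of_apply, pairingCurvature, bivectorCurvature, WeylBlocks.blockArr,
    selfDualPairs_eq_sdIdx, antiSelfDualPairs_eq_asdIdx]

variable [FiniteDimensional ℝ E] [CompleteSpace E] [Fact (1 ≤ n)]

variable {g cov} in
/-- **All Levi-Civita connections of a `C²` metric have the same Hamilton blocks** (their curvature
tensors coincide with `g.riemann`, `IsLeviCivita.curvature_eq_riemann`; O'Neill 1983, Thm. 3.11 with
Lemma 3.35). [cite: ONeill1983, Ch. 3, Thm. 3.11 and Lemma 3.35] -/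
theorem blocks_eq_leviCivita_of_isLeviCivita [g.HasLeviCivita] (h : g.IsLeviCivita cov) (hn : 2 ≤ n)
    (x : M) (e : Fin 4 → TangentSpace I x) :
    (g.blockA cov x e, g.blockB cov x e, g.blockC cov x e) =
      (g.blockA g.leviCivita x e, g.blockB g.leviCivita x e, g.blockC g.leviCivita x e) := by
  have hfun : g.curvatureForm cov x = g.curvatureForm g.leviCivita x := by
    funext X Y Z W
    simp only [curvatureForm, h.curvature_eq_riemann hn x]
    rfl
  simp only [blockA, blockB, blockC, pairingCurvature, bivectorCurvature, hfun]

variable [g.HasLeviCivita]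

/-- **`‖A‖² + 2‖B‖² + ‖C‖² = Σ_{ijkl} Rm(eᵢ,eⱼ,e_k,e_l)²`** for the blocks of the Levi-Civita
connection of a `C²` metric in ANY `4`-frame (`sum_sq_eq_blockArr` with the curvature symmetries of
O'Neill 1983, Prop. 3.36). [cite: ChangGurskyYang2003, (0.2) and Remark 2] -/
theorem rmNormSq_blocks_eq_curvNormSqFrame (hn : 2 ≤ n) (x : M) (e : Fin 4 → TangentSpace I x) :
    rmNormSq (g.blockA g.leviCivita x e, g.blockB g.leviCivita x e, g.blockC g.leviCivita x e) =
      g.curvNormSqFrame x e := by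
  have hLC : g.IsLeviCivita g.leviCivita := isLeviCivita_leviCivita_holds
  set R : Fin 4 → Fin 4 → Fin 4 → Fin 4 → ℝ :=
    fun a b c d ↦ g.curvatureForm g.leviCivita x (e a) (e b) (e c) (e d)
  have h12 : ∀ a b c d, R a b c d = -R b a c d :=
    fun a b c d ↦ g.curvatureForm_antisymm g.leviCivita x (e a) (e b) (e c) (e d)
  have h34 : ∀ a b c d, R a b c d = -R a b d c :=
    fun a b c d ↦ g.curvatureForm_leviCivita_antisymm₃₄ hn x (e a) (e b) (e c) (e d)
  have hp : ∀ a b c d, R a b c d = R c d a b :=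
    fun a b c d ↦ hLC.val_curvature_pair_symm hn x (e a) (e b) (e c) (e d)
  have key := sum_sq_eq_blockArr R h12 h34 hp
  have hA : ∀ i j, g.blockA g.leviCivita x e i j =
      WeylBlocks.blockArr WeylBlocks.sdIdx WeylBlocks.sdIdx R i j := blockA_eq_blockArr g g.leviCivita e
  have hB : ∀ i j, g.blockB g.leviCivita x e i j =
      WeylBlocks.blockArr WeylBlocks.sdIdx WeylBlocks.asdIdx R i j := blockB_eq_blockArr g g.leviCivita e
  have hC : ∀ i j, g.blockC g.leviCivita x e i j =
      WeylBlocks.blockArr WeylBlocks.asdIdx WeylBlocks.asdIdx R i j := blockC_eq_blockArr g g.leviCivita e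
  rw [curvNormSqFrame]
  change _ = ∑ i, ∑ j, ∑ k, ∑ l, R i j k l ^ 2
  rw [key]
  simp only [rmNormSq, frobSq, hA, hB, hC]

/-- **`tr A + tr C = R(x)` in an orthonormal `4`-frame** on a `4`-dimensional model, for the
Levi-Civita connection (`trace_blockA_add_trace_blockC`; Chen–Zhu 2006, p. 4: `tr A = tr C = ½R`).
[cite: ChenZhu2006, §2, p. 4] -/
theorem scal_blocks_eq (hn : 2 ≤ n) (hE : finrank ℝ E = 4) {x : M} {e : Fin 4 → TangentSpace I x}
    (he : g.IsOrthonormalFrame x e) :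
    scal (g.blockA g.leviCivita x e, g.blockB g.leviCivita x e, g.blockC g.leviCivita x e) =
      g.scalarCurvature x := by
  have hLC : g.IsLeviCivita g.leviCivita := isLeviCivita_leviCivita_holds
  have hι : Fintype.card (Fin 4) = finrank ℝ E := by rw [Fintype.card_fin, hE]
  have h := trace_blockA_add_trace_blockC x hLC hn (he.toBasis hι)
    (by rw [he.coe_toBasis hι]; exact he)
  rw [he.coe_toBasis hι] at h
  rw [scal]
  exact h.trans (g.scalarCurvatureWith_leviCivita x)

/-- **Margerin's deviation of the blocks is `|W|² + 2|E|²`** in an orthonormal `4`-frame on a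
`4`-dimensional model (`|𝒟|² = |Rm|² − R²/6`, `|Rm|² = |W|² + 2|E|² + R²/6`, Besse 1987, 1.114;
Chang–Gursky–Yang 2003, (0.2): `|Z|² = |W|² + 2|E|²`; Margerin 1998, p. 25).
[cite: ChangGurskyYang2003, (0.2)] [cite: Margerin1998, Part I, p. 25] -/
theorem devNormSq_blocks_eq (hn : 2 ≤ n) (hE : finrank ℝ E = 4) {x : M}
    {e : Fin 4 → TangentSpace I x} (he : g.IsOrthonormalFrame x e) :
    devNormSq (g.blockA g.leviCivita x e, g.blockB g.leviCivita x e, g.blockC g.leviCivita x e) =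
      g.weylNormSqFrame x e + 2 * g.tracelessRicciNormSqFrame x e := by
  rw [devNormSq, rmNormSq_blocks_eq_curvNormSqFrame g hn x e, scal_blocks_eq g hn hE he,
    g.curvNormSqFrame_eq hn hE he]
  ring

end Dictionary

end Literature.Geometry.Riemannian.HamiltonPinchedFlow

end Part2

/-!
## Part 3 — port of `Summits/SmoothPoincare4/SmoothPoincare4/Theorems/EntropyRungChangGurskyYangStubMaximalFlow.lean` (1 declarations kept)

# The maximal Ricci flow from a pinched metric is finite-time (Hamilton 1982, Thm. 14.1; Topping 2006, Cor. 3.2.4)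

Declarations of this Part (verbatim port; each keeps its own docstring and citation): `stub_maximalFlow`.

References: R. S. Hamilton, *Three-manifolds with positive Ricci curvature*, J. Differential Geom. 17 (1982) 255–306 [Hamilton1982]; P. Topping, *Lectures on the Ricci flow*, LMS Lecture Note Series 325, CUP 2006 [Topping2006]; R. S. Hamilton, *Four-manifolds with positive curvature operator*, J. Differential Geom. 24 (1986) 153–179 [Hamilton1986].
-/

section Part3

open _root_.Set _root_.Function _root_.Module _root_.Filter
open scoped _root_.Manifold _root_.ContDiff _root_.Matrix _root_.BigOperators _root_.Topology

namespace Literature.Geometry.Riemannian.HamiltonPinchedFlow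

open Literature.Geometry.Riemannian Literature.Geometry.Riemannian.HamiltonODE
open Literature.Geometry.Lorentzian Literature.Geometry.Lorentzian.PseudoRiemannianMetric

/-- **THE MAXIMAL FLOW FROM `g₀` IS FINITE-TIME** (Hamilton 1982, Thm. 14.1 = tree theorem
`ricciFlow_maximal_existence_holds`: immortal flow or maximal flow on `[0, T)`; the immortal alternative is
excluded because the pinching hypothesis, applied to that flow restricted to `[0, 4/(2m) + 1)`
(`IsRicciFlow.mono`) at `t = 0`, gives `R = tr A + tr C ≥ m > 0` in an orthonormal basis at every point
(`exists_basis_isOrthonormalFrame`, `trace_blockA_add_trace_blockC`), whence `4/(2m) + 1 ≤ 4/(2m)` by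
Topping's Cor. 3.2.4 (`ricciFlow_singularTime_le_holds`). Only the `{R ≥ m}` face of `pinchingSet` is used.
[cite: Hamilton1982, §14, Thm. 14.1 (p. 296)] [cite: Topping2006, Cor. 3.2.4 (p. 36)]
[cite: Hamilton1986, §5, 5.2 (p. 164)] -/
theorem stub_maximalFlow :
    ∀ (M : Type) [TopologicalSpace M] [T2Space M] [SecondCountableTopology M]
      [ChartedSpace (EuclideanSpace ℝ (Fin 4)) M] [IsManifold (𝓡 4) ∞ M] [CompactSpace M]
      [ConnectedSpace M]
      (g₀ : PseudoRiemannianMetric (𝓡 4) ∞ (EuclideanSpace ℝ (Fin 4)) (TangentSpace (𝓡 4) : M → Type _))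
      (m c K τ : ℝ), g₀.IsRiemannian → 0 < m →
      (∀ (T : ℝ)
        (g : ℝ → PseudoRiemannianMetric (𝓡 4) ∞ (EuclideanSpace ℝ (Fin 4))
          (TangentSpace (𝓡 4) : M → Type _))
        (cov : ℝ → CovariantDerivative (𝓡 4) (EuclideanSpace ℝ (Fin 4))
          (TangentSpace (𝓡 4) : M → Type _)),
        IsRicciFlow g cov (Ico 0 T) → (∀ t ∈ Ico 0 T, (g t).IsRiemannian) → g 0 = g₀ →
        ∀ t ∈ Ico 0 T, ∀ (x : M) (e : Fin 4 → TangentSpace (𝓡 4) x),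
          (g t).IsOrthonormalFrame x e →
            ((g t).blockA (cov t) x e, (g t).blockB (cov t) x e, (g t).blockC (cov t) x e) ∈
              pinchingSet m c K τ) →
      ∃ (T : ℝ) (g : ℝ → PseudoRiemannianMetric (𝓡 4) ∞ (EuclideanSpace ℝ (Fin 4))
          (TangentSpace (𝓡 4) : M → Type _))
        (cov : ℝ → CovariantDerivative (𝓡 4) (EuclideanSpace ℝ (Fin 4))
          (TangentSpace (𝓡 4) : M → Type _)),
        IsMaximalRicciFlow g cov T ∧ g 0 = g₀ := by
  intro M _ _ _ _ _ _ _ g₀ m c K τ hg₀ hm hpinch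
  rcases ricciFlow_maximal_existence_holds (𝓡 4) M g₀ hg₀ with
    ⟨g, cov, hflow, hR, h0⟩ | ⟨T, -, g, cov, hmax, h0⟩
  · -- an immortal flow from pinched data is impossible: `T₁ ≤ 4/(2m)` for `T₁ = 4/(2m) + 1`
    exfalso
    set T₁ : ℝ := 4 / (2 * m) + 1 with hT₁def
    have hT₁ : 0 < T₁ := by positivity
    have hflow₁ : IsRicciFlow g cov (Ico 0 T₁) := hflow.mono Ico_subset_Ici_self
    have hR₁ : ∀ t ∈ Ico 0 T₁, (g t).IsRiemannian := fun t ht ↦ hR t ht.1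
    have h0mem : (0 : ℝ) ∈ Ico 0 T₁ := ⟨le_rfl, hT₁⟩
    have hLC : (g 0).IsLeviCivita (cov 0) := hflow₁.isLeviCivita 0 h0mem
    have hn : (2 : ℕ∞ω) ≤ ∞ := WithTop.coe_le_coe.mpr le_top
    have hE : finrank ℝ (EuclideanSpace ℝ (Fin 4)) = 4 := finrank_euclideanSpace_fin
    -- the `{R ≥ m}` face of the pinching set at `t = 0`, read through `tr A + tr C = R`
    have hscal : ∀ x : M, m ≤ (g 0).scalarCurvatureWith (cov 0) x := by
      intro x
      obtain ⟨b, hb⟩ := (g 0).exists_basis_isOrthonormalFrame (x := x)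
        (fun v hv ↦ hR₁ 0 h0mem x v hv) hE
      have hmem := hpinch T₁ g cov hflow₁ hR₁ h0 0 h0mem x b hb
      have hface : m ≤ ((g 0).blockA (cov 0) x b).trace + ((g 0).blockC (cov 0) x b).trace :=
        (mem_pinchingSet.1 hmem).2.1
      rwa [trace_blockA_add_trace_blockC x hLC hn b hb] at hface
    have hle := ricciFlow_singularTime_le_holds (𝓡 4) M T₁ hT₁ g cov hflow₁ hR₁ m hm hscal
    have hrank : (finrank ℝ (EuclideanSpace ℝ (Fin 4)) : ℝ) = 4 := by rw [hE]; norm_num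
    rw [hrank] at hle
    have : (4 / (2 * m) + 1 : ℝ) ≤ 4 / (2 * m) := hle
    linarith
  · exact ⟨T, g, cov, hmax, h0⟩

end Literature.Geometry.Riemannian.HamiltonPinchedFlow

end Part3

/-!
## Part 4 — port of `Summits/SmoothPoincare4/SmoothPoincare4/Theorems/EntropyRungChangGurskyYangStubInvariantPinching.lean` (1 declarations kept)

# Invariance of the pinching sets along the flow, read through the block dictionary

Declarations of this Part (verbatim port; each keeps its own docstring and citation): `stub_invariantPinching`.

References: C. Margerin, *A sharp characterization of the smooth 4-sphere in curvature terms*, Comm. Anal. Geom. 6 (1998) 21–65 [Margerin1998]; S.-Y. A. Chang, M. J. Gursky, P. C. Yang, *A conformally invariant sphere theorem in four dimensions*, Publ. Math. IHÉS 98 (2003) 105–143 [ChangGurskyYang2003]; R. S. Hamilton, *Four-manifolds with positive curvature operator*, J. Differential Geom. 24 (1986) 153–179 [Hamilton1986].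
-/

section Part4

open _root_.Set _root_.Function _root_.Module
open scoped _root_.Manifold _root_.ContDiff _root_.Matrix _root_.BigOperators _root_.Topology

namespace Literature.Geometry.Riemannian.HamiltonPinchedFlow

open Literature.Geometry.Riemannian Literature.Geometry.Riemannian.HamiltonODE
open Literature.Geometry.Lorentzian Literature.Geometry.Lorentzian.PseudoRiemannianMetric

/-! ## The pinching set in invariant form -/

/-- **THE PINCHING SET IN INVARIANT FORM (dictionary).** If the Hamilton blocks of a
Levi-Civita connection of a `C^∞` Riemannian metric on a 4-manifold lie in `pinchingSet m c K τ` in every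
orthonormal frame, then pointwise `m ≤ R` and `|W|² + 2|E|² ≤ K R^{2−τ}`: at each point pick an
orthonormal frame (`exists_basis_isOrthonormalFrame`), pass to `g.leviCivita`
(`blocks_eq_leviCivita_of_isLeviCivita`), and read `tr A + tr C = R` (`scal_blocks_eq`),
`|𝒟|² = Σ W² + 2 Σ E²` (`devNormSq_blocks_eq`) with `|W|²`, `|E|²` the frame values
(`weylNormSq_eq_weylNormSqFrame_four`, `tracelessRicciNormSq_eq_tracelessRicciNormSqFrame_four`). The
cone face `WP ≤ c` is not needed and is dropped.
[cite: Margerin1998, Part I, p. 25] [cite: ChangGurskyYang2003, (0.2)] -/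
theorem stub_invariantPinching :
    ∀ (M : Type) [TopologicalSpace M] [T2Space M] [SecondCountableTopology M]
      [ChartedSpace (EuclideanSpace ℝ (Fin 4)) M] [IsManifold (𝓡 4) ∞ M]
      (g : PseudoRiemannianMetric (𝓡 4) ∞ (EuclideanSpace ℝ (Fin 4)) (TangentSpace (𝓡 4) : M → Type _))
      [g.HasLeviCivita]
      (cov : CovariantDerivative (𝓡 4) (EuclideanSpace ℝ (Fin 4)) (TangentSpace (𝓡 4) : M → Type _))
      (m c K τ : ℝ), g.IsRiemannian → g.IsLeviCivita cov →
      (∀ (x : M) (e : Fin 4 → TangentSpace (𝓡 4) x), g.IsOrthonormalFrame x e →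
        (g.blockA cov x e, g.blockB cov x e, g.blockC cov x e) ∈ pinchingSet m c K τ) →
      ∀ x : M, m ≤ g.scalarCurvature x ∧
        g.weylNormSq x + 2 * g.tracelessRicciNormSq x ≤ K * g.scalarCurvature x ^ (2 - τ) := by
  intro M _ _ _ _ _ g _ cov m c K τ hg hcov hpinch x
  have hn : (2 : ℕ∞ω) ≤ ∞ := WithTop.coe_le_coe.mpr le_top
  have hE : finrank ℝ (EuclideanSpace ℝ (Fin 4)) = 4 := finrank_euclideanSpace_fin
  -- an orthonormal frame at `x`
  obtain ⟨b, hb⟩ := g.exists_basis_isOrthonormalFrame (x := x) (hg x) hE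
  -- the hypothesis in that frame, transported to the canonical Levi-Civita connection
  have hmem := hpinch x b hb
  rw [blocks_eq_leviCivita_of_isLeviCivita hcov hn x b, mem_pinchingSet] at hmem
  obtain ⟨-, hscal_le, hdev_le⟩ := hmem
  -- the dictionary: `scal = R(x)`, `|𝒟|² = Σ W² + 2 Σ E² = |W|² + 2|E|²`
  rw [scal_blocks_eq g hn hE hb] at hscal_le hdev_le
  rw [devNormSq_blocks_eq g hn hE hb, ← g.weylNormSq_eq_weylNormSqFrame_four hE hb,
    ← g.tracelessRicciNormSq_eq_tracelessRicciNormSqFrame_four hE hb] at hdev_le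
  exact ⟨hscal_le, hdev_le⟩

end Literature.Geometry.Riemannian.HamiltonPinchedFlow

end Part4

/-!
## Part 5 — port of `Summits/SmoothPoincare4/SmoothPoincare4/Theorems/EntropyRungChangGurskyYangStubGradientEstimatesEvolution.lean` (4 declarations kept)

# Hamilton's evolution inequality for `u = |∇R|²/R + N|E|² − ηR²` on the manifold (Hamilton 1982, §11; Huisken 1985, Thm. 4.1)

Declarations of this Part (verbatim port; each keeps its own docstring and citation): `chart_derivWithin_hamiltonU_le`, `chart_normSqAt_ricAt_eq`, `contMDiffAt_of_chart_eq`, `helper_hamiltonEvolution`.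

References: R. S. Hamilton, *Three-manifolds with positive Ricci curvature*, J. Differential Geom. 17 (1982) 255–306 [Hamilton1982]; G. Huisken, *Ricci deformation of the metric on a Riemannian manifold*, J. Differential Geom. 21 (1985) 47–62 [Huisken1985]; P. Topping, *Lectures on the Ricci flow*, LMS Lecture Note Series 325, CUP 2006 [Topping2006].
-/

section Part5

-- nested operator spaces of metric components (`E →L E →L ℝ` and their derivatives)
set_option maxSynthPendingDepth 3

open _root_.Set _root_.Function _root_.Filter _root_.Module
open scoped _root_.Manifold _root_.ContDiff _root_.Topology

namespace Literature.Geometry.Riemannian.HamiltonPinchedFlow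

open Literature.Geometry.Riemannian
open Literature.Geometry.Lorentzian Literature.Geometry.Lorentzian.PseudoRiemannianMetric
open Literature.Geometry.Lorentzian.MetricCoord

/-! ### The `−ηS²` correction in coordinates -/

section Chart

variable {E : Type*} [NormedAddCommGroup E] [NormedSpace ℝ E] [FiniteDimensional ℝ E]
  [CompleteSpace E] {G : ℝ → E → E →L[ℝ] E →L[ℝ] ℝ} {S : Set ℝ} {V : Set E} {x : E} {t : ℝ}

/-- **Hamilton's evolution inequality for `u = F − ηS²`, `F = |∇S|²/S + N|E|²`, in coordinates
(dimension 4).** Along `∂G/∂t = −2 Ric(G)` on `V × S`, at `t ∈ S` and a positive definite point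
`x ∈ V` with `S(G t) > 0` on `V` and `|E|²(x) ≤ ΛS(x)²`, for `N = 180(1 + Λ)` and every real `η`:
`∂ₜu ≤ Δu + (2η − 1)|∇S|² + N(64√|Rm|² + S)|E|² − 4ηS|Ric|²` — the landed inequality for `F`
(`derivWithin_hamiltonF_le`, Hamilton 1982 Lemmas 11.5–11.9) minus `4η` times
`∂ₜ(S²/4) = Δ(S²/4) − |∇S|²/2 + S|Ric|²` (`hasDerivWithinAt_scalAt_sq_div_four_ricciFlow`).
[cite: Hamilton1982, §11, Lemmas 11.5–11.9, Thm. 11.1] [cite: Huisken1985, §4, Thm. 4.1] -/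
theorem chart_derivWithin_hamiltonU_le (hG : IsMetricFamilyOn G S V)
    (hfl : ∀ s ∈ S, ∀ y ∈ V, tDeriv G S s y = (-2 : ℝ) • ricAt (G s) y)
    (hx : x ∈ V) (ht : t ∈ S) (h4 : finrank ℝ E = 4)
    (hpos : ∀ v : E, v ≠ 0 → 0 < G t x v v) (hS : ∀ y ∈ V, 0 < scalAt (G t) y)
    {Λ : ℝ} (hΛ0 : 0 ≤ Λ)
    (hΛ : normSqAt (G t) x (ricAt (G t) x) - scalAt (G t) x ^ 2 / 4 ≤ Λ * scalAt (G t) x ^ 2)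
    (η : ℝ) :
    derivWithin (fun s ↦ gradSqAt (G s) (scalAt (G s)) x / scalAt (G s) x
        + 180 * (1 + Λ) * (normSqAt (G s) x (ricAt (G s) x) - scalAt (G s) x ^ 2 / 4)
        - η * scalAt (G s) x ^ 2) S t
      ≤ lapAt (G t) (fun y ↦ gradSqAt (G t) (scalAt (G t)) y / scalAt (G t) y
            + 180 * (1 + Λ) * (normSqAt (G t) y (ricAt (G t) y) - scalAt (G t) y ^ 2 / 4)
            - η * scalAt (G t) y ^ 2) x
        + ((2 * η - 1) * gradSqAt (G t) (scalAt (G t)) x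
          + 180 * (1 + Λ) * (64 * Real.sqrt (rmNormSqAt (G t) x) + scalAt (G t) x)
              * (normSqAt (G t) x (ricAt (G t) x) - scalAt (G t) x ^ 2 / 4)
          - 4 * η * (scalAt (G t) x * normSqAt (G t) x (ricAt (G t) x))) := by
  classical
  have hGt := hG.isMetricOn t ht
  have hV := hG.isOpen ht
  have hU := hG.uniqueDiffOn t ht
  set b := Module.finBasis ℝ E with hb
  have hSpos : 0 < scalAt (G t) x := hS x hx
  have hSne : scalAt (G t) x ≠ 0 := hSpos.ne'
  -- the landed inequality for `F`
  have hF_le := hG.derivWithin_hamiltonF_le hfl hx ht h4 hpos hS hΛ0 hΛ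
  -- time derivatives of the pieces
  have hVt := hG.hasDerivWithinAt_gradSqAt_scalAt_ricciFlow hfl hx ht
  have hSt := hG.hasDerivWithinAt_scalAt_ricciFlow hfl hx ht
  have hRic := hG.hasDerivWithinAt_normSqAt_ricAt_ricciFlow b hfl hx ht
  have hSq := hG.hasDerivWithinAt_scalAt_sq_div_four_ricciFlow hfl hx ht
  have hFd : DifferentiableWithinAt ℝ (fun s ↦ gradSqAt (G s) (scalAt (G s)) x / scalAt (G s) x
      + 180 * (1 + Λ) * (normSqAt (G s) x (ricAt (G s) x) - scalAt (G s) x ^ 2 / 4)) S t :=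
    ((hVt.div hSt hSne).add ((hRic.sub hSq).const_mul (180 * (1 + Λ)))).differentiableWithinAt
  -- `ηS² = 4η · (S²/4)` in time …
  have hfun : (fun s ↦ gradSqAt (G s) (scalAt (G s)) x / scalAt (G s) x
      + 180 * (1 + Λ) * (normSqAt (G s) x (ricAt (G s) x) - scalAt (G s) x ^ 2 / 4)
      - η * scalAt (G s) x ^ 2) = fun s ↦ (gradSqAt (G s) (scalAt (G s)) x / scalAt (G s) x
      + 180 * (1 + Λ) * (normSqAt (G s) x (ricAt (G s) x) - scalAt (G s) x ^ 2 / 4))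
      - 4 * η * (scalAt (G s) x ^ 2 / 4) := by
    funext s; ring
  have hu : HasDerivWithinAt (fun s ↦ (gradSqAt (G s) (scalAt (G s)) x / scalAt (G s) x
      + 180 * (1 + Λ) * (normSqAt (G s) x (ricAt (G s) x) - scalAt (G s) x ^ 2 / 4))
      - 4 * η * (scalAt (G s) x ^ 2 / 4))
      (derivWithin (fun s ↦ gradSqAt (G s) (scalAt (G s)) x / scalAt (G s) x
        + 180 * (1 + Λ) * (normSqAt (G s) x (ricAt (G s) x) - scalAt (G s) x ^ 2 / 4)) S t
      - 4 * η * (lapAt (G t) (fun y ↦ scalAt (G t) y ^ 2 / 4) x - gradSqAt (G t) (scalAt (G t)) x / 2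
        + scalAt (G t) x * normSqAt (G t) x (ricAt (G t) x))) S t :=
    hFd.hasDerivWithinAt.sub (hSq.const_mul (4 * η))
  rw [hfun, hu.derivWithin hU]
  -- … and in space
  have hScont : ContDiffOn ℝ ∞ (scalAt (G t)) V := hGt.contDiffOn_scalAt
  have hVcont : ContDiffOn ℝ ∞ (gradSqAt (G t) (scalAt (G t))) V := hGt.contDiffOn_gradSqAt hScont
  have hucont : ContDiffOn ℝ ∞ (fun y ↦ gradSqAt (G t) (scalAt (G t)) y / scalAt (G t) y) V :=
    hVcont.div hScont fun y hy ↦ (hS y hy).ne'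
  have hRcont : ContDiffOn ℝ ∞ (fun y ↦ normSqAt (G t) y (ricAt (G t) y)) V :=
    hGt.contDiffOn_normSqAt hGt.contDiffOn_ricAt
  have hEcont : ContDiffOn ℝ ∞
      (fun y ↦ normSqAt (G t) y (ricAt (G t) y) - scalAt (G t) y ^ 2 / 4) V :=
    hRcont.sub ((hScont.pow 2).div_const 4)
  have hFcont : ContDiffOn ℝ ∞ (fun y ↦ gradSqAt (G t) (scalAt (G t)) y / scalAt (G t) y
      + 180 * (1 + Λ) * (normSqAt (G t) y (ricAt (G t) y) - scalAt (G t) y ^ 2 / 4)) V :=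
    hucont.add (contDiffOn_const.mul hEcont)
  have two : (2 : ℕ∞ω) ≤ ∞ := WithTop.coe_le_coe.mpr le_top
  have hF2 : ContDiffAt ℝ 2 (fun y ↦ gradSqAt (G t) (scalAt (G t)) y / scalAt (G t) y
      + 180 * (1 + Λ) * (normSqAt (G t) y (ricAt (G t) y) - scalAt (G t) y ^ 2 / 4)) x :=
    (hFcont.contDiffAt (hV.mem_nhds hx)).of_le two
  have hS2q : ContDiffAt ℝ 2 (fun y ↦ scalAt (G t) y ^ 2 / 4) x :=
    (((hScont.pow 2).div_const 4).contDiffAt (hV.mem_nhds hx)).of_le two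
  have hfun' : (fun y ↦ gradSqAt (G t) (scalAt (G t)) y / scalAt (G t) y
      + 180 * (1 + Λ) * (normSqAt (G t) y (ricAt (G t) y) - scalAt (G t) y ^ 2 / 4)
      - η * scalAt (G t) y ^ 2) = fun y ↦ (gradSqAt (G t) (scalAt (G t)) y / scalAt (G t) y
      + 180 * (1 + Λ) * (normSqAt (G t) y (ricAt (G t) y) - scalAt (G t) y ^ 2 / 4))
      - 4 * η * (scalAt (G t) y ^ 2 / 4) := by
    funext y; ring
  rw [hfun', lapAt_sub (G t) hF2 (contDiffAt_const.mul hS2q), lapAt_const_mul (G t) hS2q]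
  linarith only [hF_le]

end Chart

/-! ### Transport to the manifold -/

section Manifold

variable {M : Type*} [TopologicalSpace M] [ChartedSpace (EuclideanSpace ℝ (Fin 4)) M]
  [IsManifold (𝓡 4) ∞ M]
  {g : ℝ → PseudoRiemannianMetric (𝓡 4) ∞ (EuclideanSpace ℝ (Fin 4)) (TangentSpace (𝓡 4) : M → Type _)}
  {cov : ℝ → CovariantDerivative (𝓡 4) (EuclideanSpace ℝ (Fin 4)) (TangentSpace (𝓡 4) : M → Type _)}
  {T' : ℝ}

/-- **`|Ric|²` of the flow read in the chart**, at every point of the chart target: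
`|Ric(G s)|²(u) = |Ric(g s)|²(Φ u)` for the Levi-Civita witness `cov s` (`normSq_chartPullback_eq`,
`ricci_comap_apply`, `OpensChart.normSq_ricci_eq_normSqAt`, `IsLeviCivita.ricci_eq_ricci`); the
`(𝓡 4)`-instance of `normSqAt_chartRep_ricAt_eq` of the sibling file `…StubGradientEstimatesSmooth`
(kept local so that this file does not depend on it). [cite: Topping2006, Prop. 2.5.4] -/
theorem chart_normSqAt_ricAt_eq (hflow : IsRicciFlow g cov (Icc 0 T')) (x₀ : M) {s : ℝ}
    (hs : s ∈ Icc 0 T') (u : chartTarget (𝓡 4) x₀) :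
    normSqAt (chartRep (𝓡 4) g x₀ s) u (ricAt (chartRep (𝓡 4) g x₀ s) u) =
      (g s).normSq (chartInv (𝓡 4) x₀ u) ((cov s).ricci (chartInv (𝓡 4) x₀ u)) := by
  haveI := (g s).hasLeviCivita
  haveI := (chartPullback (𝓡 4) (g s) x₀).hasLeviCivita
  have h2 : (2 : ℕ∞ω) ≤ ∞ := WithTop.coe_le_coe.mpr le_top
  have hG := val_chartPullback_eq_chartRep g x₀ s
  rw [← OpensChart.normSq_ricci_eq_normSqAt hG u,
    normSq_chartPullback_eq (g s) x₀ u _ ((g s).ricci (chartInv (𝓡 4) x₀ u))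
      (fun v w ↦ (g s).ricci_comap_apply contMDiff_pullbackBilin_holds (contMDiff_chartInv x₀)
        (injective_mfderiv_chartInv x₀) rfl u v w),
    (hflow.isLeviCivita s hs).ricci_eq_ricci h2]

/-- A function whose chart representative at `x₀` is `C^∞` on the chart target is `C^∞` at `x₀`
(the pattern of `contMDiffAt_curvNormSqWith`). [cite: Hamilton1982, §11, Lemmas 11.5–11.9, Thm. 11.1] -/
theorem contMDiffAt_of_chart_eq (x₀ : M) {F : M → ℝ} {Fc : EuclideanSpace ℝ (Fin 4) → ℝ}
    (hrep : ∀ y : chartTarget (𝓡 4) x₀, F (chartInv (𝓡 4) x₀ y) = Fc y)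
    (hFc : ContDiffOn ℝ ∞ Fc (extChartAt (𝓡 4) x₀).target) :
    ContMDiffAt (𝓡 4) 𝓘(ℝ, ℝ) ∞ F x₀ := by
  have hΦ : ContMDiffOn (𝓡 4) 𝓘(ℝ, EuclideanSpace ℝ (Fin 4)) ∞ (extChartAt (𝓡 4) x₀)
      (chartAt (EuclideanSpace ℝ (Fin 4)) x₀).source := contMDiffOn_extChartAt
  have hmaps : MapsTo (extChartAt (𝓡 4) x₀) (chartAt (EuclideanSpace ℝ (Fin 4)) x₀).source
      (extChartAt (𝓡 4) x₀).target := by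
    intro y hy
    exact (extChartAt (𝓡 4) x₀).map_source (by rw [extChartAt_source]; exact hy)
  have hcomp := (contMDiffOn_iff_contDiffOn.2 hFc).comp hΦ hmaps
  have heq : ∀ y ∈ (chartAt (EuclideanSpace ℝ (Fin 4)) x₀).source,
      F y = (Fc ∘ extChartAt (𝓡 4) x₀) y := by
    intro y hy
    have hyt : extChartAt (𝓡 4) x₀ y ∈ (extChartAt (𝓡 4) x₀).target := hmaps hy
    have hinv : chartInv (𝓡 4) x₀ ⟨extChartAt (𝓡 4) x₀ y, hyt⟩ = y :=
      (extChartAt (𝓡 4) x₀).left_inv (by rw [extChartAt_source]; exact hy)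
    rw [Function.comp_apply, ← hrep ⟨extChartAt (𝓡 4) x₀ y, hyt⟩, hinv]
  exact ((hcomp.congr heq) x₀ (mem_chart_source _ x₀)).contMDiffAt
    ((chartAt (EuclideanSpace ℝ (Fin 4)) x₀).open_source.mem_nhds (mem_chart_source _ x₀))

/-- **Hamilton's evolution inequality for `u = |∇R|²/R + N|E|² − ηR²` along a Ricci flow on a
smooth 4-manifold** (Hamilton 1982, §11, Lemmas 11.5–11.9 / Thm. 11.1 and Lemma 17.4; Huisken
1985, Thm. 4.1): for a Ricci flow `(g, cov)` of Riemannian metrics on `[0, T']`, `T' > 0`, at a time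
`t` where `R > 0` on `M` and a point `x` where `|E|² ≤ ΛR²` (`Λ ≥ 0`), with `N = 180(1 + Λ)` and any
real `η`, the function `u = |∇R|²/R + N(|Ric|² − R²/4) − ηR²` satisfies
`∂ₜu ≤ Δ_{g(t)}u + (2η − 1)|∇R|² + N(64√|Rm|² + R)|E|² − 4ηR|Ric|²` at `(x, t)` (`∂ₜ` within
`[0, T']`, `R = scalarCurvatureWith`, `|∇R|² = gradSq`, `|Ric|² = normSq Ric`, `|Rm|² = curvNormSqWith`,
`Δ = laplaceBeltrami`): the coordinate inequality `chart_derivWithin_hamiltonU_le` in the chart at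
`x`, transported by the chart dictionary. Hypothesis H0 of `stub_gradientEstimates`.
[cite: Hamilton1982, §11, Thm. 11.1 and §17, Lemma 17.4] [cite: Huisken1985, §4, Thm. 4.1] -/
theorem helper_hamiltonEvolution : ∀ (M : Type) [TopologicalSpace M] [T2Space M] [SecondCountableTopology M] [ChartedSpace (EuclideanSpace ℝ (Fin 4)) M] [IsManifold (𝓡 4) ∞ M] (g : ℝ → PseudoRiemannianMetric (𝓡 4) ∞ (EuclideanSpace ℝ (Fin 4)) (TangentSpace (𝓡 4) : M → Type _)) (cov : ℝ → CovariantDerivative (𝓡 4) (EuclideanSpace ℝ (Fin 4)) (TangentSpace (𝓡 4) : M → Type _)) (T' Λ η : ℝ), 0 < T' → 0 ≤ Λ → IsRicciFlow g cov (Icc 0 T') → (∀ t ∈ Icc 0 T', (g t).IsRiemannian) → ∀ t ∈ Icc 0 T', (∀ y : M, 0 < (g t).scalarCurvatureWith (cov t) y) → ∀ x : M, (g t).normSq x ((cov t).ricci x) - (g t).scalarCurvatureWith (cov t) x ^ 2 / 4 ≤ Λ * (g t).scalarCurvatureWith (cov t) x ^ 2 → derivWithin (fun s ↦ (g s).gradSq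 (fun y ↦ (g s).scalarCurvatureWith (cov s) y) x / (g s).scalarCurvatureWith (cov s) x + 180 * (1 + Λ) * ((g s).normSq x ((cov s).ricci x) - (g s).scalarCurvatureWith (cov s) x ^ 2 / 4) - η * (g s).scalarCurvatureWith (cov s) x ^ 2) (Icc 0 T') t ≤ (g t).laplaceBeltrami (fun y ↦ (g t).gradSq (fun z ↦ (g t).scalarCurvatureWith (cov t) z) y / (g t).scalarCurvatureWith (cov t) y + 180 * (1 + Λ) * ((g t).normSq y ((cov t).ricci y) - (g t).scalarCurvatureWith (cov t) y ^ 2 / 4) - η * (g t).scalarCurvatureWith (cov t) y ^ 2) x + ((2 * η - 1) * (g t).gradSq (fun y ↦ (g t).scalarCurvatureWith (cov t) y) x + 180 * (1 + Λ) * (64 * Real.sqrt ((g t).curvNormSqWith (cov t) x) + (g t).scalarCurvatureWith (cov t) x) * ((g t).normSq x ((cov t).ricci x) - (g t).scalarCurvatureWith (cov t) x ^ 2 / 4) - 4 * η * ((g t).scalarCurvatureWith (cov t) x * (g t).normSq x ((cov t).ricci x))) := by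
  intro M _ _ _ _ _ g cov T' Λ η hT' hΛ0 hflow hR t ht hRpos x₀ hΛ
  have two : (2 : ℕ∞ω) ≤ ∞ := WithTop.coe_le_coe.mpr le_top
  -- (1) the flow read in the chart at `x₀` is a coordinate Ricci flow
  have hfam := hflow.isMetricFamilyOn_chartRep hT' x₀
  have hfl : ∀ s ∈ Icc 0 T', ∀ y ∈ (extChartAt (𝓡 4) x₀).target,
      tDeriv (chartRep (𝓡 4) g x₀) (Icc 0 T') s y = (-2 : ℝ) • ricAt (chartRep (𝓡 4) g x₀ s) y :=
    fun s hs y hy ↦ hflow.tDeriv_chartRep_eq hT' x₀ hs hy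
  have hu₀ : extChartAt (𝓡 4) x₀ x₀ ∈ (extChartAt (𝓡 4) x₀).target := mem_extChartAt_target x₀
  set u₀ : chartTarget (𝓡 4) x₀ := ⟨extChartAt (𝓡 4) x₀ x₀, hu₀⟩ with hu₀def
  have hΦu₀ : chartInv (𝓡 4) x₀ u₀ = x₀ := extChartAt_to_inv x₀
  have hVopen : IsOpen (extChartAt (𝓡 4) x₀).target := isOpen_extChartAt_target x₀
  -- (2) the dictionary, at every time and every point of the chart target
  have hscal : ∀ s ∈ Icc 0 T', ∀ u : chartTarget (𝓡 4) x₀,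
      scalAt (chartRep (𝓡 4) g x₀ s) u = (g s).scalarCurvatureWith (cov s) (chartInv (𝓡 4) x₀ u) :=
    fun s hs u ↦ hflow.scalAt_chartRep_eq x₀ hs u
  have hnorm : ∀ s ∈ Icc 0 T', ∀ u : chartTarget (𝓡 4) x₀,
      normSqAt (chartRep (𝓡 4) g x₀ s) u (ricAt (chartRep (𝓡 4) g x₀ s) u) =
        (g s).normSq (chartInv (𝓡 4) x₀ u) ((cov s).ricci (chartInv (𝓡 4) x₀ u)) :=
    fun s hs u ↦ chart_normSqAt_ricAt_eq hflow x₀ hs u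
  have hRsmooth : ∀ s ∈ Icc 0 T', ContMDiff (𝓡 4) 𝓘(ℝ, ℝ) ∞
      (fun y ↦ (g s).scalarCurvatureWith (cov s) y) := fun s hs ↦
    (hflow.isLeviCivita s hs).contMDiff_trace_ricci
  have hgrad : ∀ s ∈ Icc 0 T', ∀ u : chartTarget (𝓡 4) x₀,
      gradSqAt (chartRep (𝓡 4) g x₀ s) (scalAt (chartRep (𝓡 4) g x₀ s)) u =
        (g s).gradSq (fun y ↦ (g s).scalarCurvatureWith (cov s) y) (chartInv (𝓡 4) x₀ u) := by
    intro s hs u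
    refine gradSqAt_chartRep_eq g x₀ s u (F := fun y ↦ (g s).scalarCurvatureWith (cov s) y)
      (Fc := scalAt (chartRep (𝓡 4) g x₀ s)) (fun y ↦ (hscal s hs y).symm) ?_ ?_
    · exact ((hRsmooth s hs) _).mdifferentiableAt (by simp)
    · exact ((hfam.isMetricOn s hs).contDiffAt_scalAt u.2).differentiableAt (by simp)
  have hrm : ∀ s ∈ Icc 0 T', rmNormSqAt (chartRep (𝓡 4) g x₀ s) u₀ = (g s).curvNormSqWith (cov s) x₀ :=
    fun s hs ↦ by
      have h := curvNormSqWith_chartInv_eq (hflow.isLeviCivita s hs) x₀ u₀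
      rw [hΦu₀] at h
      exact h.symm
  -- (3) the coordinate inequality at `(u₀, t)`
  have hpos : ∀ v : EuclideanSpace ℝ (Fin 4), v ≠ 0 → 0 < chartRep (𝓡 4) g x₀ t u₀ v v :=
    fun v hv ↦ chartRep_posDef g x₀ t (hR t ht) u₀ v hv
  have hS : ∀ y ∈ (extChartAt (𝓡 4) x₀).target, 0 < scalAt (chartRep (𝓡 4) g x₀ t) y := by
    intro y hy
    rw [hscal t ht ⟨y, hy⟩]
    exact hRpos _
  have hΛ' : normSqAt (chartRep (𝓡 4) g x₀ t) u₀ (ricAt (chartRep (𝓡 4) g x₀ t) u₀)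
      - scalAt (chartRep (𝓡 4) g x₀ t) u₀ ^ 2 / 4 ≤ Λ * scalAt (chartRep (𝓡 4) g x₀ t) u₀ ^ 2 := by
    rw [hnorm t ht u₀, hscal t ht u₀, hΦu₀]
    exact hΛ
  have key := chart_derivWithin_hamiltonU_le hfam hfl hu₀ ht finrank_euclideanSpace_fin hpos hS
    hΛ0 hΛ' η
  -- (4) transport of the function (time direction)
  have hfun : ∀ s ∈ Icc 0 T',
      (g s).gradSq (fun y ↦ (g s).scalarCurvatureWith (cov s) y) x₀ / (g s).scalarCurvatureWith (cov s) x₀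
        + 180 * (1 + Λ) * ((g s).normSq x₀ ((cov s).ricci x₀) - (g s).scalarCurvatureWith (cov s) x₀ ^ 2 / 4)
        - η * (g s).scalarCurvatureWith (cov s) x₀ ^ 2 =
      gradSqAt (chartRep (𝓡 4) g x₀ s) (scalAt (chartRep (𝓡 4) g x₀ s)) u₀
          / scalAt (chartRep (𝓡 4) g x₀ s) u₀
        + 180 * (1 + Λ) * (normSqAt (chartRep (𝓡 4) g x₀ s) u₀ (ricAt (chartRep (𝓡 4) g x₀ s) u₀)
          - scalAt (chartRep (𝓡 4) g x₀ s) u₀ ^ 2 / 4)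
        - η * scalAt (chartRep (𝓡 4) g x₀ s) u₀ ^ 2 := by
    intro s hs
    rw [hgrad s hs u₀, hnorm s hs u₀, hscal s hs u₀, hΦu₀]
  have hderiv : derivWithin (fun s ↦
      (g s).gradSq (fun y ↦ (g s).scalarCurvatureWith (cov s) y) x₀ / (g s).scalarCurvatureWith (cov s) x₀
        + 180 * (1 + Λ) * ((g s).normSq x₀ ((cov s).ricci x₀) - (g s).scalarCurvatureWith (cov s) x₀ ^ 2 / 4)
        - η * (g s).scalarCurvatureWith (cov s) x₀ ^ 2) (Icc 0 T') t =
      derivWithin (fun s ↦ gradSqAt (chartRep (𝓡 4) g x₀ s) (scalAt (chartRep (𝓡 4) g x₀ s)) u₀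
          / scalAt (chartRep (𝓡 4) g x₀ s) u₀
        + 180 * (1 + Λ) * (normSqAt (chartRep (𝓡 4) g x₀ s) u₀ (ricAt (chartRep (𝓡 4) g x₀ s) u₀)
          - scalAt (chartRep (𝓡 4) g x₀ s) u₀ ^ 2 / 4)
        - η * scalAt (chartRep (𝓡 4) g x₀ s) u₀ ^ 2) (Icc 0 T') t :=
    derivWithin_congr (fun s hs ↦ hfun s hs) (hfun t ht)
  -- (5) transport of the Laplacian (space direction, at time `t`)
  have hGt := hfam.isMetricOn t ht
  have hScont : ContDiffOn ℝ ∞ (scalAt (chartRep (𝓡 4) g x₀ t)) (extChartAt (𝓡 4) x₀).target :=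
    hGt.contDiffOn_scalAt
  have hVcont := hGt.contDiffOn_gradSqAt hScont
  have hRcont : ContDiffOn ℝ ∞ (fun y ↦ normSqAt (chartRep (𝓡 4) g x₀ t) y
      (ricAt (chartRep (𝓡 4) g x₀ t) y)) (extChartAt (𝓡 4) x₀).target :=
    hGt.contDiffOn_normSqAt hGt.contDiffOn_ricAt
  have hUc : ContDiffOn ℝ ∞ (fun y ↦ gradSqAt (chartRep (𝓡 4) g x₀ t) (scalAt (chartRep (𝓡 4) g x₀ t)) y
        / scalAt (chartRep (𝓡 4) g x₀ t) y
      + 180 * (1 + Λ) * (normSqAt (chartRep (𝓡 4) g x₀ t) y (ricAt (chartRep (𝓡 4) g x₀ t) y)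
        - scalAt (chartRep (𝓡 4) g x₀ t) y ^ 2 / 4)
      - η * scalAt (chartRep (𝓡 4) g x₀ t) y ^ 2) (extChartAt (𝓡 4) x₀).target :=
    ((hVcont.div hScont fun y hy ↦ (hS y hy).ne').add
      (contDiffOn_const.mul (hRcont.sub ((hScont.pow 2).div_const 4)))).sub
      (contDiffOn_const.mul (hScont.pow 2))
  have hrep : ∀ y : chartTarget (𝓡 4) x₀,
      (fun z ↦ (g t).gradSq (fun w ↦ (g t).scalarCurvatureWith (cov t) w) z / (g t).scalarCurvatureWith (cov t) z
        + 180 * (1 + Λ) * ((g t).normSq z ((cov t).ricci z) - (g t).scalarCurvatureWith (cov t) z ^ 2 / 4)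
        - η * (g t).scalarCurvatureWith (cov t) z ^ 2) (chartInv (𝓡 4) x₀ y) =
      gradSqAt (chartRep (𝓡 4) g x₀ t) (scalAt (chartRep (𝓡 4) g x₀ t)) y
          / scalAt (chartRep (𝓡 4) g x₀ t) y
        + 180 * (1 + Λ) * (normSqAt (chartRep (𝓡 4) g x₀ t) y (ricAt (chartRep (𝓡 4) g x₀ t) y)
          - scalAt (chartRep (𝓡 4) g x₀ t) y ^ 2 / 4)
        - η * scalAt (chartRep (𝓡 4) g x₀ t) y ^ 2 := by
    intro y
    simp only [hgrad t ht y, hnorm t ht y, hscal t ht y]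
  have hF : ContMDiffAt (𝓡 4) 𝓘(ℝ, ℝ) 2
      (fun z ↦ (g t).gradSq (fun w ↦ (g t).scalarCurvatureWith (cov t) w) z / (g t).scalarCurvatureWith (cov t) z
        + 180 * (1 + Λ) * ((g t).normSq z ((cov t).ricci z) - (g t).scalarCurvatureWith (cov t) z ^ 2 / 4)
        - η * (g t).scalarCurvatureWith (cov t) z ^ 2) (chartInv (𝓡 4) x₀ u₀) := by
    rw [hΦu₀]
    exact (contMDiffAt_of_chart_eq x₀ hrep hUc).of_le two
  have hFc : ContDiffAt ℝ 2 (fun y ↦ gradSqAt (chartRep (𝓡 4) g x₀ t) (scalAt (chartRep (𝓡 4) g x₀ t)) y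
        / scalAt (chartRep (𝓡 4) g x₀ t) y
      + 180 * (1 + Λ) * (normSqAt (chartRep (𝓡 4) g x₀ t) y (ricAt (chartRep (𝓡 4) g x₀ t) y)
        - scalAt (chartRep (𝓡 4) g x₀ t) y ^ 2 / 4)
      - η * scalAt (chartRep (𝓡 4) g x₀ t) y ^ 2) (u₀ : EuclideanSpace ℝ (Fin 4)) :=
    (hUc.contDiffAt (hVopen.mem_nhds hu₀)).of_le two
  have hlap := lapAt_chartRep_eq g x₀ t u₀ hrep hF hFc
  rw [hΦu₀] at hlap
  -- (6) assemble
  rw [hlap, hrm t ht, hgrad t ht u₀, hnorm t ht u₀, hscal t ht u₀, hΦu₀] at key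
  rw [hderiv]
  exact key

end Manifold

end Literature.Geometry.Riemannian.HamiltonPinchedFlow

end Part5

/-!
## Part 6 — port of `Summits/SmoothPoincare4/SmoothPoincare4/Theorems/EntropyRungChangGurskyYangStubGradientEstimatesSmooth.lean` (7 declarations kept)

# `|∇R|²` and `|Ric|²` are smooth on space-time along a Ricci flow

Declarations of this Part (verbatim port; each keeps its own docstring and citation): `contDiffOn_normSqAt_family`, `contDiffOn_normSqAt_ricAt_family`, `isRicciFlow_contMDiffOn_gradSq_scalarCurvatureWith`, `normSqAt_chartRep_ricAt_eq`, `isRicciFlow_contMDiffOn_normSq_ricci`, `helper_hamiltonSmoothGradSq`, `helper_hamiltonSmoothRicciNormSq`.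

References: R. S. Hamilton, *Three-manifolds with positive Ricci curvature*, J. Differential Geom. 17 (1982) 255–306 [Hamilton1982]; P. Topping, *Lectures on the Ricci flow*, LMS Lecture Note Series 325, CUP 2006 [Topping2006]; B. O'Neill, *Semi-Riemannian Geometry*, Academic Press 1983 [ONeill1983].
-/

section Part6

-- nested operator spaces of metric components (`E →L E →L ℝ` and their flips)
set_option maxSynthPendingDepth 3

open _root_.Set _root_.Function _root_.Filter
open scoped _root_.Manifold _root_.ContDiff _root_.Topology

namespace Literature.Geometry.Riemannian.HamiltonPinchedFlow

open Literature.Geometry.Riemannian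
open Literature.Geometry.Lorentzian Literature.Geometry.Lorentzian.PseudoRiemannianMetric

/-! ### Chart level: the metric square norm along a smooth family of components -/

section Coord

variable {E : Type*} [NormedAddCommGroup E] [NormedSpace ℝ E] [FiniteDimensional ℝ E]
  [CompleteSpace E] {G : ℝ → E → E →L[ℝ] E →L[ℝ] ℝ} {S : Set ℝ} {V : Set E}

/-- **The metric square norm along a smooth family is jointly smooth**: for a field of bilinear
forms `β : E × ℝ → (E →L E →L ℝ)`, `C^∞` on `V × S`, `(y, t) ↦ |β(y,t)|²_{G t}(y)` is `C^∞` on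
`V × S` (`|β|² = tr ((♯∘β) ∘ (♯∘βᵗ))`, `♯` jointly smooth: `contDiffOn_sharpAt_family`; companion
of the tree's `IsMetricFamilyOn.contDiffOn_mtrAt_family`). [cite: Topping2006, §1.2.3] -/
theorem contDiffOn_normSqAt_family (hG : MetricCoord.IsMetricFamilyOn G S V)
    {β : E × ℝ → E →L[ℝ] E →L[ℝ] ℝ} (hβ : ContDiffOn ℝ ∞ β (V ×ˢ S)) :
    ContDiffOn ℝ ∞ (fun q : E × ℝ ↦ MetricCoord.normSqAt (G q.2) q.1 (β q)) (V ×ˢ S) := by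
  simp only [MetricCoord.normSqAt_eq_traceCLM]
  have hflip : ContDiffOn ℝ ∞ (fun q ↦ (β q).flip) (V ×ˢ S) :=
    (ContinuousLinearMap.flipₗᵢ ℝ E E ℝ).contDiff.comp_contDiffOn hβ
  exact (MetricCoord.traceCLM E).contDiff.comp_contDiffOn
    ((hG.contDiffOn_sharpAt_family.clm_comp hβ).clm_comp
      (hG.contDiffOn_sharpAt_family.clm_comp hflip))

/-- **`|Ric|²` of a smooth family of components is jointly smooth**: `(y, t) ↦ |Ric(G t)|²_{G t}(y)`
is `C^∞` on `V × S` (`contDiffOn_normSqAt_family` with `IsMetricFamilyOn.contDiffOn_ricAt_family`).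
[cite: Topping2006, §1.2.3] -/
theorem contDiffOn_normSqAt_ricAt_family (hG : MetricCoord.IsMetricFamilyOn G S V) :
    ContDiffOn ℝ ∞ (fun q : E × ℝ ↦ MetricCoord.normSqAt (G q.2) q.1 (MetricCoord.ricAt (G q.2) q.1))
      (V ×ˢ S) :=
  contDiffOn_normSqAt_family hG hG.contDiffOn_ricAt_family

end Coord

/-! ### Manifold level: `|∇R|²` and `|Ric|²` along a Ricci flow -/

section General

variable {E : Type*} [NormedAddCommGroup E] [NormedSpace ℝ E] [FiniteDimensional ℝ E]
  [CompleteSpace E] {H : Type*} [TopologicalSpace H] {I : ModelWithCorners ℝ E H} [I.Boundaryless]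
  {M : Type*} [TopologicalSpace M] [ChartedSpace H M] [IsManifold I ∞ M]
  {g : ℝ → PseudoRiemannianMetric I ∞ E (TangentSpace I : M → Type _)}
  {cov : ℝ → CovariantDerivative I E (TangentSpace I : M → Type _)} {T : ℝ}

/-- **`|∇R|²` is `C^∞` on space-time along a Ricci flow on `[0, T]`, `T > 0`**: `R` is `C^∞` on
`M × [0, T]` (`IsRicciFlow.contMDiffOn_scalarCurvatureWith`) and the gradient square of a smooth
space-time function along the smooth family `g` is smooth on space-time
(`IsContMDiffFamilyOn.contMDiffOn_gradSq`). [cite: Topping2006, §1.2.3] -/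
theorem isRicciFlow_contMDiffOn_gradSq_scalarCurvatureWith (hflow : IsRicciFlow g cov (Icc 0 T))
    (hT : 0 < T) :
    ContMDiffOn (I.prod 𝓘(ℝ, ℝ)) 𝓘(ℝ, ℝ) ∞
      (fun p : M × ℝ ↦ (g p.2).gradSq (fun y ↦ (g p.2).scalarCurvatureWith (cov p.2) y) p.1)
      (univ ×ˢ Icc 0 T) :=
  hflow.smooth.contMDiffOn_gradSq (uniqueDiffOn_Icc hT)
    (f := fun t y ↦ (g t).scalarCurvatureWith (cov t) y) hflow.contMDiffOn_scalarCurvatureWith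

/-- **`|Ric|²` of the flow read in the chart**: for the Levi-Civita witness `cov t` of the flow,
`normSqAt (G t) u (ricAt (G t) u) = |Ric(g t)|²(Φ u)` at every point `u` of the chart target at
`x₀` (`G = chartRep I g x₀`, `Φ = chartInv I x₀`; `OpensChart.normSq_ricci_eq_normSqAt`,
`normSq_chartPullback_eq`, `ricci_comap_apply`, `IsLeviCivita.ricci_eq_ricci`).
[cite: ONeill1983, Ch. 3, Prop. 3.59] -/
theorem normSqAt_chartRep_ricAt_eq (hflow : IsRicciFlow g cov (Icc 0 T)) (x₀ : M) {t : ℝ}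
    (ht : t ∈ Icc 0 T) (u : chartTarget I x₀) :
    MetricCoord.normSqAt (chartRep I g x₀ t) u (MetricCoord.ricAt (chartRep I g x₀ t) u) =
      (g t).normSq (chartInv I x₀ u) ((cov t).ricci (chartInv I x₀ u)) := by
  haveI := (g t).hasLeviCivita
  haveI := (chartPullback I (g t) x₀).hasLeviCivita
  have h2 : (2 : ℕ∞ω) ≤ ∞ := WithTop.coe_le_coe.mpr le_top
  have hG := val_chartPullback_eq_chartRep g x₀ t
  rw [← Literature.Geometry.Lorentzian.OpensChart.normSq_ricci_eq_normSqAt hG u,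
    normSq_chartPullback_eq (g t) x₀ u _ ((g t).ricci (chartInv I x₀ u))
      (fun v w ↦ (g t).ricci_comap_apply contMDiff_pullbackBilin_holds (contMDiff_chartInv x₀)
        (injective_mfderiv_chartInv x₀) rfl u v w),
    (hflow.isLeviCivita t ht).ricci_eq_ricci h2]

/-- **`|Ric|²` is `C^∞` on space-time along a Ricci flow on `[0, T]`, `T > 0`** (Topping 2006,
§1.2.3: the curvature of a smooth family is smooth on space-time): in the chart at `x` the
function is `normSqAt (G t) y (ricAt (G t) y)` for the chart components `G = chartRep I g x`
(`normSqAt_chartRep_ricAt_eq`), jointly smooth on `(chart target) × [0, T]` by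
`contDiffOn_normSqAt_ricAt_family` for the family `IsRicciFlow.isMetricFamilyOn_chartRep` — the
proof of `IsRicciFlow.contMDiffOn_curvNormSqWith` with `|Ric|²` for `|Rm|²`. [cite: Topping2006, §1.2.3] -/
theorem isRicciFlow_contMDiffOn_normSq_ricci (hflow : IsRicciFlow g cov (Icc 0 T)) (hT : 0 < T) :
    ContMDiffOn (I.prod 𝓘(ℝ, ℝ)) 𝓘(ℝ, ℝ) ∞
      (fun p : M × ℝ ↦ (g p.2).normSq p.1 ((cov p.2).ricci p.1)) (univ ×ˢ Icc 0 T) := by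
  intro p hp
  obtain ⟨x, t⟩ := p
  have ht : t ∈ Icc 0 T := hp.2
  -- work in the chart at `x`
  set z := x
  have hfam : ContDiffOn ℝ ∞ (fun q : E × ℝ ↦ MetricCoord.normSqAt (chartRep I g z q.2) q.1
      (MetricCoord.ricAt (chartRep I g z q.2) q.1)) ((extChartAt I z).target ×ˢ Icc 0 T) :=
    contDiffOn_normSqAt_ricAt_family (hflow.isMetricFamilyOn_chartRep hT z)
  have hΦ : ContMDiffOn (I.prod 𝓘(ℝ, ℝ)) 𝓘(ℝ, E × ℝ) ∞ (fun p : M × ℝ ↦ (extChartAt I z p.1, p.2))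
      ((chartAt H z).source ×ˢ Icc 0 T) :=
    ((contMDiffOn_extChartAt (x := z)).comp contMDiffOn_fst fun p hp ↦ hp.1).prodMk_space
      contMDiffOn_snd
  have hmaps : MapsTo (fun p : M × ℝ ↦ (extChartAt I z p.1, p.2)) ((chartAt H z).source ×ˢ Icc 0 T)
      ((extChartAt I z).target ×ˢ Icc 0 T) := by
    intro p hp
    refine ⟨(extChartAt I z).map_source ?_, hp.2⟩
    rw [extChartAt_source]
    exact hp.1
  have hcomp := (contMDiffOn_iff_contDiffOn.2 hfam).comp hΦ hmaps
  have hnhds : (chartAt H z).source ×ˢ Icc 0 T ∈ 𝓝[univ ×ˢ Icc 0 T] ((x, t) : M × ℝ) := by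
    refine mem_nhdsWithin.mpr ⟨(chartAt H z).source ×ˢ univ,
      (chartAt H z).open_source.prod isOpen_univ, ⟨mem_chart_source H z, mem_univ _⟩, ?_⟩
    rintro q ⟨⟨hq1, -⟩, ⟨-, hq2⟩⟩
    exact ⟨hq1, hq2⟩
  have hxz : (x, t) ∈ (chartAt H z).source ×ˢ Icc 0 T := ⟨mem_chart_source H z, ht⟩
  refine ((hcomp.congr fun q hq ↦ ?_) (x, t) hxz).mono_of_mem_nhdsWithin hnhds
  -- the chart identity
  have hq1 : q.1 ∈ (chartAt H z).source := hq.1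
  have hy : extChartAt I z q.1 ∈ (extChartAt I z).target :=
    (extChartAt I z).map_source (by rw [extChartAt_source]; exact hq1)
  have hinv : chartInv I z ⟨extChartAt I z q.1, hy⟩ = q.1 :=
    (extChartAt I z).left_inv (by rw [extChartAt_source]; exact hq1)
  simp only [Function.comp_apply]
  rw [normSqAt_chartRep_ricAt_eq hflow z hq.2 ⟨extChartAt I z q.1, hy⟩, hinv]

end General

/-! ### Dimension four, `E = ℝ⁴` -/

/-- **H1 — `|∇R|²` is jointly smooth on `M × [0, T']` along a Ricci flow** (Topping 2006, §1.2.3;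
the regularity hypothesis of the weak maximum principle, Thm. 3.1.1, in Hamilton 1982, Thm. 11.1):
`isRicciFlow_contMDiffOn_gradSq_scalarCurvatureWith` on a 4-manifold.
[cite: Topping2006, §1.2.3] [cite: Hamilton1982, Thm. 11.1] -/
theorem helper_hamiltonSmoothGradSq : ∀ (M : Type) [TopologicalSpace M] [T2Space M] [SecondCountableTopology M] [ChartedSpace (EuclideanSpace ℝ (Fin 4)) M] [IsManifold (𝓡 4) ∞ M] (g : ℝ → PseudoRiemannianMetric (𝓡 4) ∞ (EuclideanSpace ℝ (Fin 4)) (TangentSpace (𝓡 4) : M → Type _)) (cov : ℝ → CovariantDerivative (𝓡 4) (EuclideanSpace ℝ (Fin 4)) (TangentSpace (𝓡 4) : M → Type _)) (T' : ℝ), 0 < T' → IsRicciFlow g cov (Icc 0 T') → ContMDiffOn ((𝓡 4).prod 𝓘(ℝ, ℝ)) 𝓘(ℝ, ℝ) ∞ (fun p : M × ℝ ↦ (g p.2).gradSq (fun y ↦ (g p.2).scalarCurvatureWith (cov p.2) y) p.1) (univ ×ˢ Icc 0 T') := by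
  intro M _ _ _ _ _ g cov T' hT' hflow
  exact isRicciFlow_contMDiffOn_gradSq_scalarCurvatureWith hflow hT'

/-- **H2 — `|Ric|²` is jointly smooth on `M × [0, T']` along a Ricci flow** (Topping 2006, §1.2.3;
the regularity hypothesis of the weak maximum principle, Thm. 3.1.1, in Hamilton 1982, Thm. 11.1):
`isRicciFlow_contMDiffOn_normSq_ricci` on a 4-manifold.
[cite: Topping2006, §1.2.3] [cite: Hamilton1982, Thm. 11.1] -/
theorem helper_hamiltonSmoothRicciNormSq : ∀ (M : Type) [TopologicalSpace M] [T2Space M] [SecondCountableTopology M] [ChartedSpace (EuclideanSpace ℝ (Fin 4)) M] [IsManifold (𝓡 4) ∞ M] (g : ℝ → PseudoRiemannianMetric (𝓡 4) ∞ (EuclideanSpace ℝ (Fin 4)) (TangentSpace (𝓡 4) : M → Type _)) (cov : ℝ → CovariantDerivative (𝓡 4) (EuclideanSpace ℝ (Fin 4)) (TangentSpace (𝓡 4) : M → Type _)) (T' : ℝ), 0 < T' → IsRicciFlow g cov (Icc 0 T') → ContMDiffOn ((𝓡 4).prod 𝓘(ℝ, ℝ)) 𝓘(ℝ, ℝ)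 ∞ (fun p : M × ℝ ↦ (g p.2).normSq p.1 ((cov p.2).ricci p.1)) (univ ×ˢ Icc 0 T') := by
  intro M _ _ _ _ _ g cov T' hT' hflow
  exact isRicciFlow_contMDiffOn_normSq_ricci hflow hT'

end Literature.Geometry.Riemannian.HamiltonPinchedFlow

end Part6

/-!
## Part 7 — port of `Summits/SmoothPoincare4/SmoothPoincare4/Theorems/EntropyRungChangGurskyYangStubRoundnessRateAux.lean` (7 declarations kept)

# Type-I bounds for a pinched maximal Ricci flow on a closed 4-manifold (Hamilton 1982, §16; Topping 2006, Thm. 3.2.1)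

Declarations of this Part (verbatim port; each keeps its own docstring and citation): `hasDerivAt_roundnessComparison`, `isRicciFlow_restart`, `exists_mul_scalarCurvatureWith_le`, `exists_le_mul_scalarCurvatureWith`, `roundness_dictionary`, `roundness_scalarCurvature_unbounded`, `helper_roundnessTypeOne`.

References: R. S. Hamilton, *Three-manifolds with positive Ricci curvature*, J. Differential Geom. 17 (1982) 255–306 [Hamilton1982]; P. Topping, *Lectures on the Ricci flow*, LMS Lecture Note Series 325, CUP 2006 [Topping2006].
-/

section Part7

open _root_.Set _root_.Function _root_.Filter
open scoped _root_.Manifold _root_.ContDiff _root_.Topology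

namespace Literature.Geometry.Riemannian.HamiltonPinchedFlow

open Literature.Geometry.Riemannian
open Literature.Geometry.Lorentzian Literature.Geometry.Lorentzian.PseudoRiemannianMetric

/-- **The comparison ODE `φ' = aφ²`**: `φ(s) = b/(1 − abs)` solves it away from the pole
(Topping 2006, proof of Thm. 3.2.1, with `2/n` replaced by `a`). [cite: Topping2006, Thm. 3.2.1 (proof)] -/
theorem hasDerivAt_roundnessComparison (a b t : ℝ) (ht : 1 - a * b * t ≠ 0) :
    HasDerivAt (fun s : ℝ ↦ b / (1 - a * b * s)) (a * (b / (1 - a * b * t)) ^ 2) t := by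
  have hden : HasDerivAt (fun s : ℝ ↦ 1 - a * b * s) (-(a * b)) t := by
    simpa using ((hasDerivAt_id t).const_mul (a * b)).const_sub 1
  refine ((hasDerivAt_const t b).div hden ht).congr_deriv ?_
  rw [div_pow]
  field_simp
  ring

section General

variable {E : Type*} [NormedAddCommGroup E] [NormedSpace ℝ E] [FiniteDimensional ℝ E]
  [CompleteSpace E] {H : Type*} [TopologicalSpace H] {I : ModelWithCorners ℝ E H}
  {M : Type*} [TopologicalSpace M] [ChartedSpace H M] [IsManifold I ∞ M]
  {g : ℝ → PseudoRiemannianMetric I ∞ E (TangentSpace I : M → Type _)}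
  {cov : ℝ → CovariantDerivative I E (TangentSpace I : M → Type _)} {T : ℝ}

/-- **Restarting a Ricci flow**: `s ↦ g(s + t₁)` is a Ricci flow on every `S ⊆ [0, T − t₁)`
(`t₁ ≥ 0`; the equation is autonomous, `IsRicciFlow.comp_add_const`). [cite: Hamilton1982, §16, Lemma 16.1] -/
theorem isRicciFlow_restart (hflow : IsRicciFlow g cov (Ico 0 T)) {t₁ : ℝ} (ht₁ : 0 ≤ t₁)
    {S : Set ℝ} (hS : S ⊆ Ico 0 (T - t₁)) :
    IsRicciFlow (fun s ↦ g (s + t₁)) (fun s ↦ cov (s + t₁)) S :=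
  (hflow.comp_add_const t₁).mono fun s hs ↦ by
    have h := hS hs
    simp only [mem_preimage, mem_Ico] at h ⊢
    constructor <;> linarith [h.1, h.2]

variable [I.Boundaryless] [CompactSpace M]

/-- **`R_min(t)·(T − t) ≤ n/2` along a Ricci flow on `[0, T)`** (Hamilton 1982, §16, Lemma 16.1,
unnormalised; Topping 2006, Cor. 3.2.4 restarted at `t`): the flow `s ↦ g(s + t)` lives on
`[0, T − t)` with `R ≥ R_min(t)` initially, so `T − t ≤ n/(2R_min(t))` (`IsRicciFlow.singularTime_le`).
[cite: Hamilton1982, §16, Lemma 16.1] [cite: Topping2006, Cor. 3.2.4 (p. 36)] -/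
theorem exists_mul_scalarCurvatureWith_le [T2Space M] [SecondCountableTopology M] [Nonempty M]
    (hflow : IsRicciFlow g cov (Ico 0 T)) (hR : ∀ t ∈ Ico 0 T, (g t).IsRiemannian) {t : ℝ}
    (ht : t ∈ Ico 0 T) :
    ∃ x : M, (T - t) * (g t).scalarCurvatureWith (cov t) x ≤ Module.finrank ℝ E / 2 := by
  have hcont : Continuous fun x ↦ (g t).scalarCurvatureWith (cov t) x :=
    ((hflow.isLeviCivita t ht).contMDiff_trace_ricci).continuous
  obtain ⟨x₀, -, hmin⟩ := isCompact_univ.exists_isMinOn univ_nonempty hcont.continuousOn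
  refine ⟨x₀, ?_⟩
  set α := (g t).scalarCurvatureWith (cov t) x₀ with hα
  have hTt : 0 < T - t := sub_pos.2 ht.2
  rcases le_or_gt α 0 with hα0 | hα0
  · exact (mul_nonpos_of_nonneg_of_nonpos hTt.le hα0).trans (by positivity)
  have hflow' : IsRicciFlow (fun s ↦ g (s + t)) (fun s ↦ cov (s + t)) (Ico 0 (T - t)) :=
    isRicciFlow_restart hflow ht.1 Subset.rfl
  have hR' : ∀ s ∈ Ico 0 (T - t), (g (s + t)).IsRiemannian := fun s hs ↦
    hR (s + t) ⟨by linarith [hs.1, ht.1], by linarith [hs.2]⟩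
  have h0 : ∀ x : M, α ≤ (g (0 + t)).scalarCurvatureWith (cov (0 + t)) x := fun x ↦ by
    rw [zero_add]; exact (isMinOn_iff.mp hmin) x (mem_univ x)
  have key := hflow'.singularTime_le hTt hR' hα0 h0
  rw [le_div_iff₀ (by positivity)] at key
  linarith

/-- **`R_max(t₁) ≥ 1/(a(T − t₁))` when `2|Ric|² ≤ aR²` on `[t₁, T)` and `R` is unbounded there**
(Hamilton 1982, §16, Lemma 16.2, unnormalised). Otherwise `b = max(R_max(t₁), 0)` has
`ab(T − t₁) < 1`, and for `t ∈ (t₁, T)` the weak maximum principle (Topping 2006, Thm. 3.1.1) on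
`[0, t − t₁]` for the restarted flow, `∂ₜR = ΔR + 2|Ric|² ≤ ΔR + aR²`, `φ(s) = b/(1 − abs)`, gives
`R(·, t) ≤ φ(t − t₁) ≤ b/(1 − ab(T − t₁))`: `R` would be bounded on `[t₁, T)`.
[cite: Hamilton1982, §16, Lemma 16.2] [cite: Topping2006, Thm. 3.1.1 (p. 35)] -/
theorem exists_le_mul_scalarCurvatureWith [Nonempty M] (hflow : IsRicciFlow g cov (Ico 0 T))
    (hR : ∀ t ∈ Ico 0 T, (g t).IsRiemannian) {t₁ : ℝ} (ht₁ : t₁ ∈ Ico 0 T) {a : ℝ} (ha : 0 < a)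
    (hRic : ∀ t ∈ Ico t₁ T, ∀ x : M,
      2 * (g t).normSq x ((cov t).ricci x) ≤ a * (g t).scalarCurvatureWith (cov t) x ^ 2)
    (hunb : ∀ L : ℝ, ∃ t ∈ Ico t₁ T, ∃ x : M, L < (g t).scalarCurvatureWith (cov t) x) :
    ∃ x : M, 1 ≤ a * (T - t₁) * (g t₁).scalarCurvatureWith (cov t₁) x := by
  by_contra hcon
  push Not at hcon
  -- the maximum `b ≥ 0` of `R(·, t₁)` and `0`
  have hcont : Continuous fun x ↦ (g t₁).scalarCurvatureWith (cov t₁) x :=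
    ((hflow.isLeviCivita t₁ ht₁).contMDiff_trace_ricci).continuous
  obtain ⟨x₀, -, hmx⟩ := isCompact_univ.exists_isMaxOn univ_nonempty hcont.continuousOn
  set b := max ((g t₁).scalarCurvatureWith (cov t₁) x₀) 0 with hb
  have hb0 : 0 ≤ b := le_max_right _ _
  have hbR : ∀ x, (g t₁).scalarCurvatureWith (cov t₁) x ≤ b := fun x ↦
    ((isMaxOn_iff.mp hmx) x (mem_univ x)).trans (le_max_left _ _)
  have hTt : 0 < T - t₁ := sub_pos.2 ht₁.2
  have hb1 : a * (T - t₁) * b < 1 := by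
    rcases le_total ((g t₁).scalarCurvatureWith (cov t₁) x₀) 0 with h | h
    · rw [hb, max_eq_right h, mul_zero]; exact one_pos
    · rw [hb, max_eq_left h]; exact hcon x₀
  have hab : 0 ≤ a * b := mul_nonneg ha.le hb0
  -- the comparison function `φ(s) = b / (1 - a b s)` stays below `L₀` on `[0, T - t₁]`
  set L₀ := b / (1 - a * b * (T - t₁)) with hL₀
  have hden : ∀ s, s ≤ T - t₁ → 0 < 1 - a * b * s := fun s hs1 ↦ by
    nlinarith [mul_le_mul_of_nonneg_left hs1 hab]
  have hφle : ∀ s, s ≤ T - t₁ → b / (1 - a * b * s) ≤ L₀ := fun s hs1 ↦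
    div_le_div_of_nonneg_left hb0 (hden _ le_rfl) (by nlinarith [mul_le_mul_of_nonneg_left hs1 hab])
  -- hence `R ≤ max L₀ b` on `[t₁, T)`: contradiction
  obtain ⟨t, ht, x, hx⟩ := hunb (max L₀ b)
  refine absurd hx (not_lt.2 ?_)
  rcases ht.1.eq_or_lt with rfl | ht₁t
  · exact (hbR x).trans (le_max_right _ _)
  -- maximum principle on the window `[0, w]`, `w = t - t₁`, for the restarted flow
  set w := t - t₁ with hw
  have hw0 : 0 < w := sub_pos.2 ht₁t
  have hwT : w < T - t₁ := by rw [hw]; linarith [ht.2]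
  have hflow' : IsRicciFlow (fun s ↦ g (s + t₁)) (fun s ↦ cov (s + t₁)) (Icc 0 w) :=
    isRicciFlow_restart hflow ht₁.1 (Icc_subset_Ico_right hwT)
  have hmem : ∀ s ∈ Icc 0 w, s + t₁ ∈ Ico t₁ T := fun s hs ↦
    ⟨by linarith [hs.1], by linarith [hs.2]⟩
  have hR' : ∀ s ∈ Icc 0 w, (g (s + t₁)).IsRiemannian := fun s hs ↦
    hR _ ⟨by linarith [hs.1, ht₁.1], (hmem s hs).2⟩
  have hF : ContDiffOn ℝ 1 (uncurry fun (r : ℝ) (_ : ℝ) ↦ a * r ^ 2) (univ ×ˢ Icc 0 w) :=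
    (contDiff_const.mul (contDiff_fst.pow 2)).contDiffOn
  have hu := hflow'.contMDiffOn_scalarCurvatureWith
  have hineq : ∀ s ∈ Icc 0 w, ∀ y : M,
      derivWithin (fun r ↦ (fun s y ↦ (g (s + t₁)).scalarCurvatureWith (cov (s + t₁)) y) r y)
          (Icc 0 w) s ≤
        (g (s + t₁)).laplaceBeltrami
            ((fun s y ↦ (g (s + t₁)).scalarCurvatureWith (cov (s + t₁)) y) s) y
          + mvfderiv I ((fun s y ↦ (g (s + t₁)).scalarCurvatureWith (cov (s + t₁)) y) s) y
              ((fun (_ : ℝ) (y : M) ↦ (0 : TangentSpace I y)) s y)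
          + (fun (r : ℝ) (_ : ℝ) ↦ a * r ^ 2)
              ((fun s y ↦ (g (s + t₁)).scalarCurvatureWith (cov (s + t₁)) y) s y) s := by
    intro s hs y
    have hev := (hflow'.hasDerivWithinAt_scalarCurvatureWith hw0 hs y).derivWithin
      (uniqueDiffOn_Icc hw0 s hs)
    have hle := hRic (s + t₁) (hmem s hs) y
    simp only [map_zero, add_zero]
    rw [hev]
    linarith
  have hφ : ∀ s ∈ Icc 0 w, HasDerivWithinAt (fun r ↦ b / (1 - a * b * r))
      ((fun (r : ℝ) (_ : ℝ) ↦ a * r ^ 2) ((fun r ↦ b / (1 - a * b * r)) s) s) (Icc 0 w) s :=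
    fun s hs ↦ (hasDerivAt_roundnessComparison a b s
      (hden s (hs.2.trans hwT.le)).ne').hasDerivWithinAt
  have key := weakMaximumPrinciple (α := b) hw0 hR' (fun (_ : ℝ) (y : M) ↦ (0 : TangentSpace I y))
    hF hu hineq hφ (by simp) (fun y ↦ by simpa using hbR y) w ⟨hw0.le, le_rfl⟩ x
  have hts : w + t₁ = t := by rw [hw]; ring
  simp only [hts] at key
  exact key.trans ((hφle w hwT.le).trans (le_max_left _ _))

end General

section FourDim

variable {M : Type*} [TopologicalSpace M] [T2Space M] [SecondCountableTopology M]
  [ChartedSpace (EuclideanSpace ℝ (Fin 4)) M] [IsManifold (𝓡 4) ∞ M] [CompactSpace M]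
  {g : ℝ → PseudoRiemannianMetric (𝓡 4) ∞ (EuclideanSpace ℝ (Fin 4)) (TangentSpace (𝓡 4) : M → Type _)}
  {cov : ℝ → CovariantDerivative (𝓡 4) (EuclideanSpace ℝ (Fin 4)) (TangentSpace (𝓡 4) : M → Type _)}
  {T m K τ : ℝ}

omit [T2Space M] [SecondCountableTopology M] [CompactSpace M] in
/-- **The pinching dictionary along the flow.** With `cov t` a Levi-Civita connection of `g t`
(`IsLeviCivita.ricci_eq_ricci`, `curvature_eq_riemann`) and `|E|² = |Ric|² − R²/4`,
`|W|² = |Rm|² − 2|Ric|² + R²/3` (Besse 1987, 1.116–1.118; tree `tracelessRicciNormSq_eq_normSq`,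
`weylNormSq_eq_curvNormSqWith`), the invariant pinching reads: `m ≤ R`, `0 ≤ |E|²`, `0 ≤ |W|²`,
`|W|² + 2|E|² ≤ K R^{2−τ}` in the `cov t` quantities. [cite: Besse1987, (1.116)–1.118] -/
theorem roundness_dictionary (hflow : IsRicciFlow g cov (Ico 0 T))
    (hRiem : ∀ t ∈ Ico 0 T, (g t).IsRiemannian)
    (hpinch : ∀ t ∈ Ico 0 T, ∀ [(g t).HasLeviCivita] (x : M),
      m ≤ (g t).scalarCurvature x ∧
        (g t).weylNormSq x + 2 * (g t).tracelessRicciNormSq x ≤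
          K * (g t).scalarCurvature x ^ (2 - τ))
    {t : ℝ} (ht : t ∈ Ico 0 T) (x : M) :
    m ≤ (g t).scalarCurvatureWith (cov t) x ∧
    0 ≤ (g t).normSq x ((cov t).ricci x) - (g t).scalarCurvatureWith (cov t) x ^ 2 / 4 ∧
    0 ≤ (g t).curvNormSqWith (cov t) x - 2 * (g t).normSq x ((cov t).ricci x) +
        (g t).scalarCurvatureWith (cov t) x ^ 2 / 3 ∧
    ((g t).curvNormSqWith (cov t) x - 2 * (g t).normSq x ((cov t).ricci x) +
        (g t).scalarCurvatureWith (cov t) x ^ 2 / 3) +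
      2 * ((g t).normSq x ((cov t).ricci x) - (g t).scalarCurvatureWith (cov t) x ^ 2 / 4) ≤
      K * (g t).scalarCurvatureWith (cov t) x ^ (2 - τ) := by
  haveI := (g t).hasLeviCivita
  have h2 : (2 : ℕ∞ω) ≤ ∞ := WithTop.coe_le_coe.mpr le_top
  have hLC := hflow.isLeviCivita t ht
  have hric : (cov t).ricci x = (g t).ricci x := hLC.ricci_eq_ricci h2 x
  have hscal : (g t).scalarCurvatureWith (cov t) x = (g t).scalarCurvature x := by
    show (g t).trace x ((cov t).ricci x) = (g t).trace x ((g t).ricci x)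
    rw [hric]
  have hcurv : (g t).curvNormSqWith (cov t) x = (g t).curvNormSqWith (g t).leviCivita x :=
    (g t).curvNormSqWith_congr (hLC.curvature_eq_riemann h2 x)
  have hE := (g t).tracelessRicciNormSq_eq_normSq (hRiem t ht) finrank_euclideanSpace_fin x
  have hW := (g t).weylNormSq_eq_curvNormSqWith (hRiem t ht) finrank_euclideanSpace_fin x
  obtain ⟨hm, hp⟩ := hpinch t ht x
  have hEnn := (g t).tracelessRicciNormSq_nonneg x
  have hWnn := (g t).weylNormSq_nonneg x
  rw [hric, hscal, hcurv]
  refine ⟨hm, ?_, ?_, ?_⟩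
  · rw [← hE]; exact hEnn
  · rw [← hW]; exact hWnn
  · rw [← hE, ← hW]; exact hp

/-- **`R_max(t) → ∞` at the maximal time of a pinched flow** (Hamilton 1982, Thm. 14.1, in
Topping's form Thm. 5.3.1 = tree theorem `ricciFlow_curvature_blowup_of_shortTime
ricciFlow_shortTime_existence_holds`): for every level `L` there is `t₁` with `R(x, t) > L` at some
`x`, for all `t ∈ [t₁, T)` — failure of the frame bound `√(A L'²)` gives `|Rm|² > A L'²` somewhere
(`curvatureBoundedBy_of_curvNormSqWith_le`), and `|Rm|² ≤ K R^{2−τ} + R²/6 ≤ A R²`, `A = K m^{−τ} + 1/6`.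
[cite: Hamilton1982, §14, Thm. 14.1 (p. 296)] [cite: Topping2006, Thm. 5.3.1] -/
theorem roundness_scalarCurvature_unbounded (hmax : IsMaximalRicciFlow g cov T) (hm : 0 < m)
    (hK : 0 < K) (hτ0 : 0 < τ)
    (hpinch : ∀ t ∈ Ico 0 T, ∀ [(g t).HasLeviCivita] (x : M),
      m ≤ (g t).scalarCurvature x ∧
        (g t).weylNormSq x + 2 * (g t).tracelessRicciNormSq x ≤
          K * (g t).scalarCurvature x ^ (2 - τ))
    (L : ℝ) : ∃ t₁ ∈ Ico 0 T, ∀ t ∈ Ico t₁ T, ∃ x : M, L < (g t).scalarCurvatureWith (cov t) x := by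
  have hflow := hmax.isRicciFlow
  have hRiem := hmax.isRiemannian
  set A := K * m ^ (-τ) + 1 / 6 with hA
  set L' := max L 0 + 1 with hL'
  have hL'0 : 0 ≤ L' := by rw [hL']; positivity
  have hLL' : L < L' := by rw [hL']; linarith [le_max_left L 0]
  obtain ⟨t₁, ht₁, hviol⟩ := ricciFlow_curvature_blowup_of_shortTime
    ricciFlow_shortTime_existence_holds (𝓡 4) M T g cov hmax (Real.sqrt (A * L' ^ 2))
  refine ⟨t₁, ht₁, fun t ht ↦ ?_⟩
  have ht' : t ∈ Ico 0 T := ⟨ht₁.1.trans ht.1, ht.2⟩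
  obtain ⟨x, hx⟩ : ∃ x : M, A * L' ^ 2 < (g t).curvNormSqWith (cov t) x := by
    by_contra hcon
    push Not at hcon
    exact hviol t ht (curvatureBoundedBy_of_curvNormSqWith_le (hRiem t ht')
      (hflow.isLeviCivita t ht') hcon)
  refine ⟨x, ?_⟩
  obtain ⟨hmR, -, -, hp⟩ := roundness_dictionary hflow hRiem hpinch ht' x
  set R := (g t).scalarCurvatureWith (cov t) x with hRdef
  have hR0 : 0 < R := hm.trans_le hmR
  have hrpow : R ^ (2 - τ) ≤ m ^ (-τ) * R ^ 2 := by
    rw [Real.rpow_sub hR0, Real.rpow_two, div_eq_mul_inv, ← Real.rpow_neg hR0.le, mul_comm]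
    exact mul_le_mul_of_nonneg_right (Real.rpow_le_rpow_of_nonpos hm hmR (by linarith))
      (sq_nonneg _)
  have hKr : K * R ^ (2 - τ) ≤ K * (m ^ (-τ) * R ^ 2) := mul_le_mul_of_nonneg_left hrpow hK.le
  have hsq : L' ^ 2 < R ^ 2 := by
    by_contra hcon
    push Not at hcon
    have := mul_le_mul_of_nonneg_left hcon (by rw [hA]; positivity : 0 ≤ A)
    rw [hA] at this hx; linarith
  exact hLL'.trans (lt_of_pow_lt_pow_left₀ 2 hR0.le hsq)

/-- **HELPER — THE TYPE-I SANDWICH `1 ≤ (T−t)R ≤ 3` AT LATE TIMES** (Hamilton 1982, §16,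
Lemmas 16.1–16.5 in unnormalised clothes; feeds `stub_roundnessRate`). For a
maximal Ricci flow on a closed 4-manifold with the invariant pinching and the ratio property
`R ≥ θ R_max` at late times for every `θ < 1`, there is `t₀ ∈ [0, T)` such that for `t ∈ [t₀, T)`:
(i) `1 ≤ (T−t)R ≤ 3` and `K R^{−τ} ≤ 1/20` everywhere; (ii) if `2|Ric|² ≤ aR²` on `M × [t, T)`,
`a > 0`, some point has `a(T−t)R ≥ 1` (maximum principle + `R_max → ∞`); (iii) some point has
`(T−t)R ≤ 2` (Cor. 3.2.4 restarted at `t`). For (i) take `θ = 9/10`: `R_min → ∞` makes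
`K R^{−τ} ≤ 1/20`, so `2|Ric|² = 2|E|² + R²/2 ≤ (11/20)R²`, (ii) gives `R_max(T−t) ≥ 20/11`,
`(T−t)R ≥ θ·20/11 ≥ 1`, and (iii) gives `(T−t)R ≤ (T−t)R_min/θ ≤ 20/9 ≤ 3`.
[cite: Hamilton1982, §16, Lemmas 16.1–16.5] [cite: Topping2006, Thm. 3.1.1 and Cor. 3.2.4] -/
theorem helper_roundnessTypeOne :
    ∀ (M : Type) [TopologicalSpace M] [T2Space M] [SecondCountableTopology M]
      [ChartedSpace (EuclideanSpace ℝ (Fin 4)) M] [IsManifold (𝓡 4) ∞ M] [CompactSpace M]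
      [Nonempty M]
      (g : ℝ → PseudoRiemannianMetric (𝓡 4) ∞ (EuclideanSpace ℝ (Fin 4)) (TangentSpace (𝓡 4) : M → Type _))
      (cov : ℝ → CovariantDerivative (𝓡 4) (EuclideanSpace ℝ (Fin 4)) (TangentSpace (𝓡 4) : M → Type _))
      (T m K τ : ℝ), 0 < m → 0 < K → 0 < τ →
      IsMaximalRicciFlow g cov T →
      (∀ t ∈ Ico 0 T, ∀ [(g t).HasLeviCivita] (x : M),
        m ≤ (g t).scalarCurvature x ∧
          (g t).weylNormSq x + 2 * (g t).tracelessRicciNormSq x ≤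
            K * (g t).scalarCurvature x ^ (2 - τ)) →
      (∀ θ : ℝ, 0 < θ → θ < 1 → ∃ t₀ ∈ Ico 0 T, ∀ t ∈ Ico t₀ T, ∀ x y : M,
        θ * (g t).scalarCurvatureWith (cov t) y ≤ (g t).scalarCurvatureWith (cov t) x) →
      ∃ t₀ ∈ Ico 0 T, ∀ t ∈ Ico t₀ T,
        (∀ x : M, 1 ≤ (T - t) * (g t).scalarCurvatureWith (cov t) x ∧
          (T - t) * (g t).scalarCurvatureWith (cov t) x ≤ 3 ∧
          K * (g t).scalarCurvatureWith (cov t) x ^ (-τ) ≤ 1 / 20) ∧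
        (∀ a : ℝ, 0 < a →
          (∀ s ∈ Ico t T, ∀ x : M,
            2 * (g s).normSq x ((cov s).ricci x) ≤ a * (g s).scalarCurvatureWith (cov s) x ^ 2) →
          ∃ x : M, 1 ≤ a * (T - t) * (g t).scalarCurvatureWith (cov t) x) ∧
        (∃ x : M, (T - t) * (g t).scalarCurvatureWith (cov t) x ≤ 2) := by
  intro M _ _ _ _ _ _ _ g cov T m K τ hm hK hτ0 hmax hpinch hratio
  have hflow := hmax.isRicciFlow
  have hRiem := hmax.isRiemannian
  have hn4 : (Module.finrank ℝ (EuclideanSpace ℝ (Fin 4)) : ℝ) / 2 = 2 := by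
    rw [finrank_euclideanSpace_fin]; norm_num
  -- (iii) at every time
  have hmin : ∀ t ∈ Ico 0 T, ∃ x : M, (T - t) * (g t).scalarCurvatureWith (cov t) x ≤ 2 := by
    intro t ht
    obtain ⟨x, hx⟩ := exists_mul_scalarCurvatureWith_le hflow hRiem ht
    exact ⟨x, hx.trans_eq hn4⟩
  -- (ii) at every time: `R` is unbounded on every `[t, T)`
  have hunb : ∀ t ∈ Ico 0 T, ∀ L : ℝ, ∃ s ∈ Ico t T, ∃ x : M,
      L < (g s).scalarCurvatureWith (cov s) x := by
    intro t ht L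
    obtain ⟨t₁, ht₁, h⟩ := roundness_scalarCurvature_unbounded hmax hm hK hτ0 hpinch L
    exact ⟨max t t₁, ⟨le_max_left _ _, max_lt ht.2 ht₁.2⟩,
      h _ ⟨le_max_right _ _, max_lt ht.2 ht₁.2⟩⟩
  have hlow : ∀ t ∈ Ico 0 T, ∀ a : ℝ, 0 < a →
      (∀ s ∈ Ico t T, ∀ x : M,
        2 * (g s).normSq x ((cov s).ricci x) ≤ a * (g s).scalarCurvatureWith (cov s) x ^ 2) →
      ∃ x : M, 1 ≤ a * (T - t) * (g t).scalarCurvatureWith (cov t) x :=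
    fun t ht a ha h ↦ exists_le_mul_scalarCurvatureWith hflow hRiem ht ha h (hunb t ht)
  -- (i): the ratio at `θ = 9/10` beyond the level `R_* = (20K)^{1/τ}`
  obtain ⟨tθ, htθ, hθ⟩ := hratio (9 / 10) (by norm_num) (by norm_num)
  set Rs : ℝ := (20 * K) ^ (1 / τ) with hRs
  have h20K : 0 < 20 * K := by positivity
  have hRs0 : 0 < Rs := Real.rpow_pos_of_pos h20K _
  have hRsτ : Rs ^ (-τ) = (20 * K)⁻¹ := by
    rw [hRs, ← Real.rpow_mul h20K.le, show 1 / τ * -τ = -1 by field_simp, Real.rpow_neg_one]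
  obtain ⟨tL, htL, hL⟩ :=
    roundness_scalarCurvature_unbounded hmax hm hK hτ0 hpinch (Rs / (9 / 10))
  set t₀ := max tθ tL with ht₀
  have ht₀T : t₀ < T := max_lt htθ.2 htL.2
  have ht₀0 : 0 ≤ t₀ := le_max_of_le_left htθ.1
  -- `K R^{-τ} ≤ 1/20` on `[t₀, T)`
  have hsmall : ∀ s ∈ Ico t₀ T, ∀ x : M,
      m ≤ (g s).scalarCurvatureWith (cov s) x ∧
        K * (g s).scalarCurvatureWith (cov s) x ^ (-τ) ≤ 1 / 20 := by
    intro s hs x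
    have hs' : s ∈ Ico 0 T := ⟨ht₀0.trans hs.1, hs.2⟩
    obtain ⟨y, hy⟩ := hL s ⟨(le_max_right _ _).trans hs.1, hs.2⟩
    have hxy := hθ s ⟨(le_max_left _ _).trans hs.1, hs.2⟩ x y
    have hRx : Rs ≤ (g s).scalarCurvatureWith (cov s) x := by
      have : (9 / 10 : ℝ) * (Rs / (9 / 10)) = Rs := by ring
      nlinarith
    obtain ⟨hmR, -, -, -⟩ := roundness_dictionary hflow hRiem hpinch hs' x
    refine ⟨hmR, ?_⟩
    have h1 : (g s).scalarCurvatureWith (cov s) x ^ (-τ) ≤ Rs ^ (-τ) :=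
      Real.rpow_le_rpow_of_nonpos hRs0 hRx (by linarith)
    rw [hRsτ] at h1
    calc K * (g s).scalarCurvatureWith (cov s) x ^ (-τ) ≤ K * (20 * K)⁻¹ :=
          mul_le_mul_of_nonneg_left h1 hK.le
      _ = 1 / 20 := by field_simp
  refine ⟨t₀, ⟨ht₀0, ht₀T⟩, fun t ht ↦ ?_⟩
  have ht' : t ∈ Ico 0 T := ⟨ht₀0.trans ht.1, ht.2⟩
  have hTt : 0 < T - t := sub_pos.2 ht.2
  refine ⟨fun x ↦ ?_, hlow t ht', hmin t ht'⟩
  -- `2|Ric|² ≤ (11/20) R²` on `[t, T)`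
  have hRic : ∀ s ∈ Ico t T, ∀ y : M, 2 * (g s).normSq y ((cov s).ricci y) ≤
      11 / 20 * (g s).scalarCurvatureWith (cov s) y ^ 2 := by
    intro s hs y
    have hs' : s ∈ Ico 0 T := ⟨ht'.1.trans hs.1, hs.2⟩
    obtain ⟨hmR, -, hWnn, hp⟩ := roundness_dictionary hflow hRiem hpinch hs' y
    obtain ⟨-, hKs⟩ := hsmall s ⟨ht.1.trans hs.1, hs.2⟩ y
    set R := (g s).scalarCurvatureWith (cov s) y with hR
    have hR0 : 0 < R := hm.trans_le hmR
    have hsplit : K * R ^ (2 - τ) = K * R ^ (-τ) * R ^ 2 := by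
      rw [sub_eq_add_neg, Real.rpow_add hR0, Real.rpow_two]; ring
    have hKR : K * R ^ (2 - τ) ≤ 1 / 20 * R ^ 2 := by
      rw [hsplit]; exact mul_le_mul_of_nonneg_right hKs (sq_nonneg _)
    linarith
  obtain ⟨x₂, hx₂⟩ := hlow t ht' (11 / 20) (by norm_num) hRic
  obtain ⟨x₁, hx₁⟩ := hmin t ht'
  have htθ' : t ∈ Ico tθ T := ⟨(le_max_left _ _).trans ht.1, ht.2⟩
  have h₂ := mul_le_mul_of_nonneg_left (hθ t htθ' x x₂) hTt.le
  have h₁ := mul_le_mul_of_nonneg_left (hθ t htθ' x₁ x) hTt.le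
  exact ⟨by nlinarith, by nlinarith, (hsmall t ht x).2⟩

end FourDim

end Literature.Geometry.Riemannian.HamiltonPinchedFlow

end Part7

/-!
## Part 8 — port of `Summits/SmoothPoincare4/SmoothPoincare4/Theorems/EntropyRungChangGurskyYangStubGradientEstimatesBound.lean` (10 declarations kept)

# Hamilton's gradient estimate `|∇R|² ≤ ηR³ + C(η)` — the maximum-principle endgame (Hamilton 1982, §11, Thm. 11.1)

Declarations of this Part (verbatim port; each keeps its own docstring and citation): `gradientBound_rpow_le`, `gradientBound_traceless_le`, `gradientBound_source_le`, `gradientBound_final`, `gradientBound_val_self_nonneg`, `gradientBound_gradSq_nonneg`, `gradientBound_smooth`, `gradientBound_maxPrinciple`, `gradientBound_core`, `helper_gradientBound_of_evolution`.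

References: R. S. Hamilton, *Three-manifolds with positive Ricci curvature*, J. Differential Geom. 17 (1982) 255–306 [Hamilton1982]; P. Topping, *Lectures on the Ricci flow*, LMS Lecture Note Series 325, CUP 2006 [Topping2006].
-/

section Part8

open _root_.Set _root_.Function _root_.Filter
open scoped _root_.Manifold _root_.ContDiff _root_.Topology

namespace Literature.Geometry.Riemannian.HamiltonPinchedFlow

open Literature.Geometry.Riemannian
open Literature.Geometry.Lorentzian Literature.Geometry.Lorentzian.PseudoRiemannianMetric

/-! ### Real-variable estimates -/

/-- `K R^{2−τ} ≤ K m^{−τ} R²` for `R ≥ m > 0`, `K, τ ≥ 0` (`R^{−τ} ≤ m^{−τ}`).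
[cite: Hamilton1982, §11, Thm. 11.1] -/
theorem gradientBound_rpow_le {m K τ R : ℝ} (hm : 0 < m) (hK : 0 ≤ K) (hτ0 : 0 ≤ τ) (hmR : m ≤ R) :
    K * R ^ (2 - τ) ≤ K * m ^ (-τ) * R ^ 2 := by
  have hR0 : 0 < R := hm.trans_le hmR
  have hrpow : R ^ (2 - τ) ≤ m ^ (-τ) * R ^ 2 := by
    rw [sub_eq_add_neg, Real.rpow_add hR0, Real.rpow_two, mul_comm]
    exact mul_le_mul_of_nonneg_right (Real.rpow_le_rpow_of_nonpos hm hmR (by linarith))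
      (sq_nonneg _)
  calc K * R ^ (2 - τ) ≤ K * (m ^ (-τ) * R ^ 2) := mul_le_mul_of_nonneg_left hrpow hK
    _ = K * m ^ (-τ) * R ^ 2 := by ring

/-- **The traceless Ricci part is quadratically small**: under the pinching
`|W|² + 2|E|² ≤ K R^{2−τ}`, `|W|² ≥ 0`, `R ≥ m > 0`, one has `|E|² ≤ (K m^{−τ}/2) R²`.
[cite: Hamilton1982, §11, Thm. 11.1] -/
theorem gradientBound_traceless_le {m K τ R N W : ℝ} (hm : 0 < m) (hK : 0 ≤ K) (hτ0 : 0 ≤ τ)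
    (hmR : m ≤ R) (hW : 0 ≤ W) (hp : W + 2 * (N - R ^ 2 / 4) ≤ K * R ^ (2 - τ)) :
    N - R ^ 2 / 4 ≤ K * m ^ (-τ) / 2 * R ^ 2 := by
  have := gradientBound_rpow_le hm hK hτ0 hmR
  linarith

/-- **The source term of Hamilton's function is bounded above** (Hamilton 1982, proof of
Thm. 11.1): for `0 < η₀ ≤ 1/2`, `Λ ≥ 0` there is `C₂ ≥ 0` with
`(2η₀ − 1)V + 180(1+Λ)(64√Q + R)|E|² − 4η₀RN ≤ C₂` whenever `R ≥ m`, `V ≥ 0`, `|E|² ≥ 0`,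
`|W|² ≥ 0`, `|W|² + 2|E|² ≤ K R^{2−τ}` (`|E|² = N − R²/4`, `|W|² = Q − 2N + R²/3`): the positive
part is `≤ C₁R^{3−τ}`, the Ricci term is `≤ −η₀R³`, and `C₁R^{3−τ} − η₀R³ ≤ C₁R₀^{3−τ}`,
`R₀ = (C₁/η₀)^{1/τ}`. [cite: Hamilton1982, §11, Thm. 11.1] -/
theorem gradientBound_source_le {m K τ Λ η₀ : ℝ} (hm : 0 < m) (hK : 0 < K) (hτ0 : 0 < τ)
    (hτ1 : τ ≤ 1) (hΛ : 0 ≤ Λ) (hη₀ : 0 < η₀) (hη₀1 : η₀ ≤ 1 / 2) :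
    ∃ C₂ : ℝ, 0 ≤ C₂ ∧ ∀ R V N Q : ℝ, m ≤ R → 0 ≤ V → 0 ≤ N - R ^ 2 / 4 →
      0 ≤ Q - 2 * N + R ^ 2 / 3 →
      (Q - 2 * N + R ^ 2 / 3) + 2 * (N - R ^ 2 / 4) ≤ K * R ^ (2 - τ) →
      (2 * η₀ - 1) * V + 180 * (1 + Λ) * (64 * Real.sqrt Q + R) * (N - R ^ 2 / 4)
        - 4 * η₀ * (R * N) ≤ C₂ := by
  set A : ℝ := K * m ^ (-τ) + 1 / 6 with hA
  have hA0 : 0 < A := by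
    rw [hA]; exact add_pos_of_nonneg_of_pos (mul_nonneg hK.le (Real.rpow_nonneg hm.le _)) (by norm_num)
  set C₁ : ℝ := 90 * K * (1 + Λ) * (64 * Real.sqrt A + 1) with hC₁
  have hC₁0 : 0 ≤ C₁ := by
    rw [hC₁]
    exact mul_nonneg (mul_nonneg (mul_nonneg (by norm_num) hK.le) (by linarith))
      (add_nonneg (mul_nonneg (by norm_num) (Real.sqrt_nonneg _)) zero_le_one)
  have hC₁η : 0 ≤ C₁ / η₀ := div_nonneg hC₁0 hη₀.le
  set R₀ : ℝ := (C₁ / η₀) ^ (1 / τ) with hR₀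
  have hR₀0 : 0 ≤ R₀ := Real.rpow_nonneg hC₁η _
  refine ⟨C₁ * R₀ ^ (3 - τ), mul_nonneg hC₁0 (Real.rpow_nonneg hR₀0 _), ?_⟩
  intro R V N Q hmR hV hE hW hp
  have hR0 : 0 < R := hm.trans_le hmR
  have hKR := gradientBound_rpow_le hm hK.le hτ0.le hmR
  -- `Q ≤ A R²` and `√Q ≤ √A R`
  have hQ : Q ≤ A * R ^ 2 := by
    rw [hA]; linarith
  have hsqrt : Real.sqrt Q ≤ Real.sqrt A * R := by
    rw [Real.sqrt_le_left (mul_nonneg (Real.sqrt_nonneg _) hR0.le), mul_pow, Real.sq_sqrt hA0.le]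
    exact hQ
  -- the positive source term is `≤ C₁ R^{3-τ}`
  have hE' : N - R ^ 2 / 4 ≤ K / 2 * R ^ (2 - τ) := by linarith
  have hmain : 180 * (1 + Λ) * (64 * Real.sqrt Q + R) * (N - R ^ 2 / 4) ≤ C₁ * R ^ (3 - τ) := by
    have h1 : 64 * Real.sqrt Q + R ≤ (64 * Real.sqrt A + 1) * R := by linarith
    have h2 : 180 * (1 + Λ) * (64 * Real.sqrt Q + R) ≤ 180 * (1 + Λ) * ((64 * Real.sqrt A + 1) * R) :=
      mul_le_mul_of_nonneg_left h1 (by linarith)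
    have h3 : R * R ^ (2 - τ) = R ^ (3 - τ) := by
      rw [show (3 : ℝ) - τ = 1 + (2 - τ) by ring, Real.rpow_add hR0, Real.rpow_one]
    have h4 : 0 ≤ 180 * (1 + Λ) * ((64 * Real.sqrt A + 1) * R) :=
      mul_nonneg (by linarith) (mul_nonneg (by linarith [Real.sqrt_nonneg A]) hR0.le)
    calc 180 * (1 + Λ) * (64 * Real.sqrt Q + R) * (N - R ^ 2 / 4)
        ≤ 180 * (1 + Λ) * ((64 * Real.sqrt A + 1) * R) * (K / 2 * R ^ (2 - τ)) :=
          mul_le_mul h2 hE' hE h4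
      _ = C₁ * (R * R ^ (2 - τ)) := by rw [hC₁]; ring
      _ = C₁ * R ^ (3 - τ) := by rw [h3]
  -- the Ricci term: `4η₀ R N ≥ η₀ R³`
  have hRic : η₀ * R ^ 3 ≤ 4 * η₀ * (R * N) := by
    have h1 : R ^ 2 / 4 * R ≤ N * R := mul_le_mul_of_nonneg_right (by linarith) hR0.le
    have h2 := mul_le_mul_of_nonneg_left h1 hη₀.le
    linarith
  -- the gradient term: `(2η₀ - 1) V ≤ 0`
  have hVterm : (2 * η₀ - 1) * V ≤ 0 := by nlinarith
  have hΦ : (2 * η₀ - 1) * V + 180 * (1 + Λ) * (64 * Real.sqrt Q + R) * (N - R ^ 2 / 4)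
      - 4 * η₀ * (R * N) ≤ C₁ * R ^ (3 - τ) - η₀ * R ^ 3 := by linarith
  -- `C₁ R^{3-τ} - η₀ R³ ≤ C₁ R₀^{3-τ}`
  rcases le_or_gt R₀ R with hle | hlt
  · -- `R ≥ R₀`: `C₁ ≤ η₀ R^τ`, so the difference is `≤ 0`
    have hτR : C₁ ≤ η₀ * R ^ τ := by
      have h1 : R₀ ^ τ ≤ R ^ τ := Real.rpow_le_rpow hR₀0 hle hτ0.le
      have h2 : R₀ ^ τ = C₁ / η₀ := by
        rw [hR₀, ← Real.rpow_mul hC₁η, one_div_mul_cancel hτ0.ne', Real.rpow_one]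
      rw [h2, div_le_iff₀ hη₀] at h1
      linarith
    have h3 : R ^ τ * R ^ (3 - τ) = R ^ 3 := by
      rw [← Real.rpow_add hR0, show τ + (3 - τ) = ((3 : ℕ) : ℝ) by push_cast; ring,
        Real.rpow_natCast]
    have h4 : C₁ * R ^ (3 - τ) ≤ η₀ * R ^ 3 :=
      calc C₁ * R ^ (3 - τ) ≤ η₀ * R ^ τ * R ^ (3 - τ) :=
            mul_le_mul_of_nonneg_right hτR (Real.rpow_nonneg hR0.le _)
        _ = η₀ * R ^ 3 := by rw [mul_assoc, h3]
    have h5 : 0 ≤ C₁ * R₀ ^ (3 - τ) := mul_nonneg hC₁0 (Real.rpow_nonneg hR₀0 _)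
    linarith
  · -- `R < R₀`
    have h1 : R ^ (3 - τ) ≤ R₀ ^ (3 - τ) := Real.rpow_le_rpow hR0.le hlt.le (by linarith)
    have h2 : C₁ * R ^ (3 - τ) ≤ C₁ * R₀ ^ (3 - τ) := mul_le_mul_of_nonneg_left h1 hC₁0
    have h3 : 0 ≤ η₀ * R ^ 3 := mul_nonneg hη₀.le (pow_nonneg hR0.le 3)
    linarith

/-- **From the bound on Hamilton's function to the gradient estimate**: if
`V/R + L|E|² − η₀R² ≤ B` with `R > 0`, `L|E|² ≥ 0`, then `V ≤ 2η₀R³ + C(B, η₀)`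
(`BR ≤ η₀R³ + B⁺R₁`, `R₁ = √(B⁺/η₀)`). [cite: Hamilton1982, §11, Thm. 11.1] -/
theorem gradientBound_final {η₀ : ℝ} (hη₀ : 0 < η₀) (B : ℝ) :
    ∃ C : ℝ, ∀ R V E L : ℝ, 0 < R → 0 ≤ E → 0 ≤ L → V / R + L * E - η₀ * R ^ 2 ≤ B →
      V ≤ 2 * η₀ * R ^ 3 + C := by
  set B' : ℝ := max B 0 with hB'
  have hB'0 : 0 ≤ B' := le_max_right _ _
  have hBB' : B ≤ B' := le_max_left _ _
  set R₁ : ℝ := Real.sqrt (B' / η₀) with hR₁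
  have hR₁0 : 0 ≤ R₁ := Real.sqrt_nonneg _
  have hR₁sq : η₀ * R₁ ^ 2 = B' := by
    rw [hR₁, Real.sq_sqrt (div_nonneg hB'0 hη₀.le)]
    field_simp
  refine ⟨B' * R₁, fun R V E L hR hE hL hu ↦ ?_⟩
  have hLE : 0 ≤ L * E := mul_nonneg hL hE
  have h1 : V / R ≤ B' + η₀ * R ^ 2 := by linarith
  have h2 : V ≤ (B' + η₀ * R ^ 2) * R := (div_le_iff₀ hR).1 h1
  have key : R₁ ^ 2 * R ≤ R ^ 3 + R₁ ^ 3 := by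
    nlinarith [mul_nonneg (sq_nonneg (R - R₁)) (add_nonneg hR.le hR₁0),
      mul_nonneg (sq_nonneg R) hR₁0]
  have h3 : B' * R ≤ η₀ * R ^ 3 + B' * R₁ := by
    have := mul_le_mul_of_nonneg_left key hη₀.le
    rw [← hR₁sq]
    linarith
  linarith

/-! ### The maximum-principle step, in the abstract functions `R, V, N, Q` -/

section FourDim

variable {M : Type*} [TopologicalSpace M] [ChartedSpace (EuclideanSpace ℝ (Fin 4)) M]
  [IsManifold (𝓡 4) ∞ M] [CompactSpace M]
  {g : ℝ → PseudoRiemannianMetric (𝓡 4) ∞ (EuclideanSpace ℝ (Fin 4)) (TangentSpace (𝓡 4) : M → Type _)}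
  {T m K τ : ℝ}

omit [CompactSpace M] in
/-- `g(v, v) ≥ 0` for a Riemannian metric. [cite: Hamilton1982, §11, Thm. 11.1] -/
theorem gradientBound_val_self_nonneg
    {g₀ : PseudoRiemannianMetric (𝓡 4) ∞ (EuclideanSpace ℝ (Fin 4)) (TangentSpace (𝓡 4) : M → Type _)}
    (hg : g₀.IsRiemannian) (x : M) (v : TangentSpace (𝓡 4) x) : 0 ≤ g₀.val x v v := by
  by_cases hv : v = 0
  · rw [hv]; simp
  · exact (hg x v hv).le

omit [CompactSpace M] in
/-- `|∇ψ|²_g = g(♯dψ, ♯dψ) ≥ 0` for a Riemannian metric. [cite: Hamilton1982, §11, Thm. 11.1] -/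
theorem gradientBound_gradSq_nonneg
    {g₀ : PseudoRiemannianMetric (𝓡 4) ∞ (EuclideanSpace ℝ (Fin 4)) (TangentSpace (𝓡 4) : M → Type _)}
    (hg : g₀.IsRiemannian) (ψ : M → ℝ) (x : M) : 0 ≤ g₀.gradSq ψ x := by
  rw [PseudoRiemannianMetric.gradSq, innerDual_eq_val_sharp_sharp]
  exact gradientBound_val_self_nonneg hg x _

omit [IsManifold (𝓡 4) ∞ M] [CompactSpace M] in
/-- **Joint regularity of Hamilton's function** `u = V/R + 180(1+Λ)(N − R²/4) − η₀R²` on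
`M × [0, T']` from that of `R > 0`, `V`, `N` (smooth algebra of `C^∞` maps into `ℝ`). [cite: Hamilton1982, §11, Thm. 11.1] -/
theorem gradientBound_smooth {T' Λ η₀ : ℝ} {R V N : ℝ → M → ℝ}
    (hRs : ContMDiffOn ((𝓡 4).prod 𝓘(ℝ, ℝ)) 𝓘(ℝ, ℝ) ∞ (fun p : M × ℝ ↦ R p.2 p.1) (univ ×ˢ Icc 0 T'))
    (hVs : ContMDiffOn ((𝓡 4).prod 𝓘(ℝ, ℝ)) 𝓘(ℝ, ℝ) ∞ (fun p : M × ℝ ↦ V p.2 p.1) (univ ×ˢ Icc 0 T'))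
    (hNs : ContMDiffOn ((𝓡 4).prod 𝓘(ℝ, ℝ)) 𝓘(ℝ, ℝ) ∞ (fun p : M × ℝ ↦ N p.2 p.1) (univ ×ˢ Icc 0 T'))
    (hR0 : ∀ s ∈ Icc 0 T', ∀ x : M, 0 < R s x) :
    ContMDiffOn ((𝓡 4).prod 𝓘(ℝ, ℝ)) 𝓘(ℝ, ℝ) ∞
      (fun p : M × ℝ ↦ V p.2 p.1 / R p.2 p.1 + 180 * (1 + Λ) * (N p.2 p.1 - R p.2 p.1 ^ 2 / 4)
        - η₀ * R p.2 p.1 ^ 2) (univ ×ˢ Icc 0 T') := by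
  have hne : ∀ p ∈ univ ×ˢ Icc (0 : ℝ) T', (fun p : M × ℝ ↦ R p.2 p.1) p ≠ 0 := fun p hp ↦
    (hR0 p.2 hp.2 p.1).ne'
  exact ((hVs.div₀ hRs hne).add (contMDiffOn_const.mul (hNs.sub ((hRs.pow 2).div_const 4)))).sub
    (contMDiffOn_const.mul (hRs.pow 2))

/-- **The maximum-principle step** (Topping 2006, Thm. 3.1.1 with `X = 0`, `F ≡ C₂`,
`φ(s) = α + sC₂`): if `u = V/R + 180(1+Λ)(N − R²/4) − η₀R²` is jointly smooth on `M × [0, T']`,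
satisfies `∂ₜu ≤ Δu + Φ` with `Φ ≤ C₂`, and `u(0, ·) ≤ α`, then `u(s, ·) ≤ α + sC₂` on `[0, T']`.
[cite: Topping2006, Thm. 3.1.1 (p. 35)] -/
theorem gradientBound_maxPrinciple {T' Λ η₀ C₂ α : ℝ} (hT' : 0 < T')
    (hgR : ∀ s ∈ Icc 0 T', (g s).IsRiemannian) {R V N Q : ℝ → M → ℝ}
    (hRs : ContMDiffOn ((𝓡 4).prod 𝓘(ℝ, ℝ)) 𝓘(ℝ, ℝ) ∞ (fun p : M × ℝ ↦ R p.2 p.1) (univ ×ˢ Icc 0 T'))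
    (hVs : ContMDiffOn ((𝓡 4).prod 𝓘(ℝ, ℝ)) 𝓘(ℝ, ℝ) ∞ (fun p : M × ℝ ↦ V p.2 p.1) (univ ×ˢ Icc 0 T'))
    (hNs : ContMDiffOn ((𝓡 4).prod 𝓘(ℝ, ℝ)) 𝓘(ℝ, ℝ) ∞ (fun p : M × ℝ ↦ N p.2 p.1) (univ ×ˢ Icc 0 T'))
    (hR0 : ∀ s ∈ Icc 0 T', ∀ x : M, 0 < R s x)
    (hevol : ∀ s ∈ Icc 0 T', ∀ x : M,
      derivWithin (fun r ↦ V r x / R r x + 180 * (1 + Λ) * (N r x - R r x ^ 2 / 4)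
          - η₀ * R r x ^ 2) (Icc 0 T') s ≤
        (g s).laplaceBeltrami (fun y ↦ V s y / R s y + 180 * (1 + Λ) * (N s y - R s y ^ 2 / 4)
          - η₀ * R s y ^ 2) x +
          ((2 * η₀ - 1) * V s x + 180 * (1 + Λ) * (64 * Real.sqrt (Q s x) + R s x) *
            (N s x - R s x ^ 2 / 4) - 4 * η₀ * (R s x * N s x)))
    (hΦ : ∀ s ∈ Icc 0 T', ∀ x : M,
      (2 * η₀ - 1) * V s x + 180 * (1 + Λ) * (64 * Real.sqrt (Q s x) + R s x) *
        (N s x - R s x ^ 2 / 4) - 4 * η₀ * (R s x * N s x) ≤ C₂)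
    (hu0 : ∀ x : M, V 0 x / R 0 x + 180 * (1 + Λ) * (N 0 x - R 0 x ^ 2 / 4) - η₀ * R 0 x ^ 2 ≤ α) :
    ∀ s ∈ Icc 0 T', ∀ x : M,
      V s x / R s x + 180 * (1 + Λ) * (N s x - R s x ^ 2 / 4) - η₀ * R s x ^ 2 ≤ α + s * C₂ := by
  have hF : ContDiffOn ℝ 1 (uncurry fun (_ : ℝ) (_ : ℝ) ↦ C₂) (univ ×ˢ Icc 0 T') :=
    contDiffOn_const (c := C₂)
  have hφ : ∀ s ∈ Icc 0 T', HasDerivWithinAt (fun r : ℝ ↦ α + r * C₂)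
      ((fun (_ : ℝ) (_ : ℝ) ↦ C₂) ((fun r : ℝ ↦ α + r * C₂) s) s) (Icc 0 T') s := fun s _ ↦
    ((hasDerivAt_mul_const C₂).const_add α).hasDerivWithinAt
  refine weakMaximumPrinciple hT' hgR (fun (_ : ℝ) (y : M) ↦ (0 : TangentSpace (𝓡 4) y)) hF
    (u := fun s x ↦ V s x / R s x + 180 * (1 + Λ) * (N s x - R s x ^ 2 / 4) - η₀ * R s x ^ 2)
    (gradientBound_smooth (Λ := Λ) (η₀ := η₀) hRs hVs hNs hR0) (fun s hs x ↦ ?_) hφ (by simp) hu0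
  have h1 := hevol s hs x
  have h2 := hΦ s hs x
  simp only [map_zero, add_zero]
  linarith

/-- **Hamilton 1982, Thm. 11.1, abstract form.** For functions `R, V, N, Q` on `[0, T) × M` with
the pinching dictionary (`m ≤ R`, `0 ≤ N − R²/4`, `0 ≤ Q − 2N + R²/3`,
`(Q − 2N + R²/3) + 2(N − R²/4) ≤ K R^{2−τ}`), `V ≥ 0`, joint smoothness of `R, V, N` on every
`M × [0, T']`, and the evolution inequality `∂ₜu ≤ Δ_{g(t)}u + Φ` for
`u = V/R + 180(1+Λ)(N − R²/4) − ηR²` (all `Λ ≥ 0`, `η`, wherever `N − R²/4 ≤ ΛR²`): for every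
`η > 0` there is `C` with `V ≤ ηR³ + C` on `[0, T)`. Proof: `η₀ = min(η,1)/2`, `Λ = Km^{−τ}/2`,
`Φ ≤ C₂` (`gradientBound_source_le`), the weak maximum principle on each `[0, t]`
(`gradientBound_maxPrinciple`) gives `u ≤ α + TC₂`, and `gradientBound_final`.
[cite: Hamilton1982, §11, Thm. 11.1] -/
theorem gradientBound_core (hT : 0 < T) (hm : 0 < m) (hK : 0 < K) (hτ0 : 0 < τ) (hτ1 : τ ≤ 1)
    (hRiem : ∀ t ∈ Ico 0 T, (g t).IsRiemannian) {R V N Q : ℝ → M → ℝ}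
    (hdict : ∀ t ∈ Ico 0 T, ∀ x : M, m ≤ R t x ∧ 0 ≤ N t x - R t x ^ 2 / 4 ∧
      0 ≤ Q t x - 2 * N t x + R t x ^ 2 / 3 ∧
      (Q t x - 2 * N t x + R t x ^ 2 / 3) + 2 * (N t x - R t x ^ 2 / 4) ≤ K * R t x ^ (2 - τ))
    (hV0 : ∀ t ∈ Ico 0 T, ∀ x : M, 0 ≤ V t x)
    (hRs : ∀ T' : ℝ, 0 < T' → T' < T → ContMDiffOn ((𝓡 4).prod 𝓘(ℝ, ℝ)) 𝓘(ℝ, ℝ) ∞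
      (fun p : M × ℝ ↦ R p.2 p.1) (univ ×ˢ Icc 0 T'))
    (hVs : ∀ T' : ℝ, 0 < T' → T' < T → ContMDiffOn ((𝓡 4).prod 𝓘(ℝ, ℝ)) 𝓘(ℝ, ℝ) ∞
      (fun p : M × ℝ ↦ V p.2 p.1) (univ ×ˢ Icc 0 T'))
    (hNs : ∀ T' : ℝ, 0 < T' → T' < T → ContMDiffOn ((𝓡 4).prod 𝓘(ℝ, ℝ)) 𝓘(ℝ, ℝ) ∞
      (fun p : M × ℝ ↦ N p.2 p.1) (univ ×ˢ Icc 0 T'))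
    (hevol : ∀ (Λ η T' : ℝ), 0 ≤ Λ → 0 < T' → T' < T → ∀ t ∈ Icc 0 T', ∀ x : M,
      N t x - R t x ^ 2 / 4 ≤ Λ * R t x ^ 2 →
      derivWithin (fun s ↦ V s x / R s x + 180 * (1 + Λ) * (N s x - R s x ^ 2 / 4)
          - η * R s x ^ 2) (Icc 0 T') t ≤
        (g t).laplaceBeltrami (fun y ↦ V t y / R t y + 180 * (1 + Λ) * (N t y - R t y ^ 2 / 4)
          - η * R t y ^ 2) x +
          ((2 * η - 1) * V t x + 180 * (1 + Λ) * (64 * Real.sqrt (Q t x) + R t x) *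
            (N t x - R t x ^ 2 / 4) - 4 * η * (R t x * N t x)))
    {η : ℝ} (hη : 0 < η) :
    ∃ C : ℝ, ∀ t ∈ Ico 0 T, ∀ x : M, V t x ≤ η * R t x ^ 3 + C := by
  have hRpos : ∀ t ∈ Ico 0 T, ∀ x : M, 0 < R t x := fun t ht x ↦ hm.trans_le (hdict t ht x).1
  -- the constants `η₀ ≤ 1/2` and `Λ`
  obtain ⟨η₀, hη₀0, hη₀1, hη₀η⟩ : ∃ η₀ : ℝ, 0 < η₀ ∧ η₀ ≤ 1 / 2 ∧ 2 * η₀ ≤ η :=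
    ⟨min η 1 / 2, div_pos (lt_min hη one_pos) two_pos, by linarith [min_le_right η 1],
      by linarith [min_le_left η 1]⟩
  obtain ⟨Λ, hΛ0, hE⟩ : ∃ Λ : ℝ, 0 ≤ Λ ∧ ∀ t ∈ Ico 0 T, ∀ x : M,
      N t x - R t x ^ 2 / 4 ≤ Λ * R t x ^ 2 := by
    refine ⟨K * m ^ (-τ) / 2, div_nonneg (mul_nonneg hK.le (Real.rpow_nonneg hm.le _)) two_pos.le,
      fun t ht x ↦ ?_⟩
    obtain ⟨hmR, -, hW0, hp⟩ := hdict t ht x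
    exact gradientBound_traceless_le hm hK.le hτ0.le hmR hW0 hp
  obtain ⟨C₂, hC₂0, hC₂⟩ := gradientBound_source_le hm hK hτ0 hτ1 hΛ0 hη₀0 hη₀1
  -- `Φ ≤ C₂` along the flow
  have hΦ : ∀ t ∈ Ico 0 T, ∀ x : M, (2 * η₀ - 1) * V t x + 180 * (1 + Λ) *
      (64 * Real.sqrt (Q t x) + R t x) * (N t x - R t x ^ 2 / 4) - 4 * η₀ * (R t x * N t x) ≤ C₂ :=
    fun t ht x ↦ by
      obtain ⟨hmR, hE0, hW0, hp⟩ := hdict t ht x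
      exact hC₂ _ _ _ _ hmR (hV0 t ht x) hE0 hW0 hp
  -- restriction to `[0, T']`
  have hsub : ∀ {T' : ℝ}, T' < T → Icc 0 T' ⊆ Ico 0 T := fun hT' s hs ↦ ⟨hs.1, hs.2.trans_lt hT'⟩
  -- `α`: an upper bound for `u(0, ·)` over the compact `M`
  obtain ⟨α, hα⟩ : ∃ α : ℝ, ∀ x : M,
      V 0 x / R 0 x + 180 * (1 + Λ) * (N 0 x - R 0 x ^ 2 / 4) - η₀ * R 0 x ^ 2 ≤ α := by
    have hT2 : 0 < T / 2 := by positivity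
    have hT2T : T / 2 < T := by linarith
    have hu := gradientBound_smooth (Λ := Λ) (η₀ := η₀) (hRs _ hT2 hT2T) (hVs _ hT2 hT2T)
      (hNs _ hT2 hT2T) (fun s hs x ↦ hRpos s (hsub hT2T hs) x)
    have hcont := (contMDiff_slice (I := 𝓡 4)
      (u := fun s x ↦ V s x / R s x + 180 * (1 + Λ) * (N s x - R s x ^ 2 / 4) - η₀ * R s x ^ 2)
      hu (t := 0) ⟨le_rfl, hT2.le⟩).continuous
    obtain ⟨α, hα⟩ := (isCompact_range hcont).bddAbove
    exact ⟨α, fun x ↦ mem_upperBounds.1 hα _ (mem_range_self x)⟩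
  -- the weak maximum principle on every `[0, t]`: `u ≤ α + T C₂` on `[0, T)`
  have hub : ∀ t ∈ Ico 0 T, ∀ x : M,
      V t x / R t x + 180 * (1 + Λ) * (N t x - R t x ^ 2 / 4) - η₀ * R t x ^ 2 ≤ α + T * C₂ := by
    intro t ht x
    have hTC : 0 ≤ T * C₂ := mul_nonneg hT.le hC₂0
    rcases ht.1.eq_or_lt with h0 | ht0
    · subst h0
      linarith [hα x]
    · have key := gradientBound_maxPrinciple (R := R) (V := V) (N := N) (Q := Q) (Λ := Λ)
        (η₀ := η₀) (C₂ := C₂) (α := α) ht0 (fun s hs ↦ hRiem s (hsub ht.2 hs))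
        (hRs t ht0 ht.2) (hVs t ht0 ht.2) (hNs t ht0 ht.2) (fun s hs y ↦ hRpos s (hsub ht.2 hs) y)
        (fun s hs y ↦ hevol Λ η₀ t hΛ0 ht0 ht.2 s hs y (hE s (hsub ht.2 hs) y))
        (fun s hs y ↦ hΦ s (hsub ht.2 hs) y) hα t ⟨ht0.le, le_rfl⟩ x
      have htC : t * C₂ ≤ T * C₂ := mul_le_mul_of_nonneg_right ht.2.le hC₂0
      linarith
  -- conclusion
  obtain ⟨C, hC⟩ := gradientBound_final hη₀0 (α + T * C₂)
  refine ⟨C, fun t ht x ↦ ?_⟩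
  have h1 := hC (R t x) (V t x) (N t x - R t x ^ 2 / 4) (180 * (1 + Λ)) (hRpos t ht x)
    (hdict t ht x).2.1 (mul_nonneg (by norm_num) (by linarith)) (hub t ht x)
  have hR3 : 0 ≤ R t x ^ 3 := pow_nonneg (hRpos t ht x).le 3
  linarith [mul_le_mul_of_nonneg_right hη₀η hR3]

end FourDim

/-! ### Main statement -/

/-- **HELPER H3 — HAMILTON'S GRADIENT ESTIMATE `|∇R|² ≤ ηR³ + C(η)` (Hamilton 1982, §11,
Thm. 11.1), the weak-maximum-principle endgame.** Along a Ricci flow on `[0, T)` on a closed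
4-manifold with the invariant pinching `m ≤ R`, `|W|² + 2|E|² ≤ K R^{2−τ}`, GIVEN the joint
smoothness of `|∇R|²` and `|Ric|²` on every `M × [0, T']` and the evolution inequality
`∂ₜu ≤ Δu + (2η−1)|∇R|² + 180(1+Λ)(64√|Rm|² + R)|E|² − 4ηR|Ric|²` for
`u = |∇R|²/R + 180(1+Λ)|E|² − ηR²` (every `Λ ≥ 0`, `η`, `0 < T' < T`, wherever `|E|² ≤ ΛR²`):
for every `η > 0` there is `C` with `|∇R|² ≤ ηR³ + C` on `M × [0, T)`. Proof: `gradientBound_core`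
with `R, V = |∇R|², N = |Ric|², Q = |Rm|²` read through the flow's Levi-Civita witness
(`roundness_dictionary`), `V ≥ 0` (`gradientBound_gradSq_nonneg`) and the joint regularity of `R`
(`IsRicciFlow.contMDiffOn_scalarCurvatureWith`). [cite: Hamilton1982, §11, Thm. 11.1] -/
theorem helper_gradientBound_of_evolution : ∀ (M : Type) [TopologicalSpace M] [T2Space M] [SecondCountableTopology M] [ChartedSpace (EuclideanSpace ℝ (Fin 4)) M] [IsManifold (𝓡 4) ∞ M] [CompactSpace M] (g : ℝ → PseudoRiemannianMetric (𝓡 4) ∞ (EuclideanSpace ℝ (Fin 4)) (TangentSpace (𝓡 4) : M → Type _)) (cov : ℝ → CovariantDerivative (𝓡 4) (EuclideanSpace ℝ (Fin 4)) (TangentSpace (𝓡 4) : M → Type _)) (T m K τ : ℝ), 0 < T → 0 < m → 0 < K → 0 < τ → τ ≤ 1 → IsRicciFlow g cov (Ico 0 T) → (∀ t ∈ Ico 0 T, (g t).IsRiemannian) → (∀ t ∈ Ico 0 T, ∀ [(g t).HasLeviCivita] (x : M), m ≤ (g t).scalarCurvature x ∧ (g t).weylNormSq x + 2 * (g t).tracelessRicciNormSq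 x ≤ K * (g t).scalarCurvature x ^ (2 - τ)) → (∀ T' : ℝ, 0 < T' → T' < T → ContMDiffOn ((𝓡 4).prod 𝓘(ℝ, ℝ)) 𝓘(ℝ, ℝ) ∞ (fun p : M × ℝ ↦ (g p.2).gradSq (fun y ↦ (g p.2).scalarCurvatureWith (cov p.2) y) p.1) (univ ×ˢ Icc 0 T')) → (∀ T' : ℝ, 0 < T' → T' < T → ContMDiffOn ((𝓡 4).prod 𝓘(ℝ, ℝ)) 𝓘(ℝ, ℝ) ∞ (fun p : M × ℝ ↦ (g p.2).normSq p.1 ((cov p.2).ricci p.1)) (univ ×ˢ Icc 0 T')) → (∀ (Λ η T' : ℝ), 0 ≤ Λ → 0 < T' → T' < T → ∀ t ∈ Icc 0 T', ∀ x : M, (g t).normSq x ((cov t).ricci x) - (g t).scalarCurvatureWith (cov t) x ^ 2 / 4 ≤ Λ * (g t).scalarCurvatureWith (cov t) x ^ 2 → derivWithin (fun s ↦ (g s).gradSq (fun y ↦ (g s).scalarCurvatureWith (cov s) y) x / (g s).scalarCurvatureWith (cov s) x + 180 * (1 + Λ) * ((g s).normSq x ((cov s).ricci x) - (g s).scalarCurvatureWith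 (cov s) x ^ 2 / 4) - η * (g s).scalarCurvatureWith (cov s) x ^ 2) (Icc 0 T') t ≤ (g t).laplaceBeltrami (fun y ↦ (g t).gradSq (fun z ↦ (g t).scalarCurvatureWith (cov t) z) y / (g t).scalarCurvatureWith (cov t) y + 180 * (1 + Λ) * ((g t).normSq y ((cov t).ricci y) - (g t).scalarCurvatureWith (cov t) y ^ 2 / 4) - η * (g t).scalarCurvatureWith (cov t) y ^ 2) x + ((2 * η - 1) * (g t).gradSq (fun y ↦ (g t).scalarCurvatureWith (cov t) y) x + 180 * (1 + Λ) * (64 * Real.sqrt ((g t).curvNormSqWith (cov t) x) + (g t).scalarCurvatureWith (cov t) x) * ((g t).normSq x ((cov t).ricci x) - (g t).scalarCurvatureWith (cov t) x ^ 2 / 4) - 4 * η * ((g t).scalarCurvatureWith (cov t) x * (g t).normSq x ((cov t).ricci x)))) → ∀ η : ℝ, 0 < η → ∃ C : ℝ, ∀ t ∈ Ico 0 T, ∀ x : M, (g t).gradSq (fun y ↦ (g t).scalarCurvatureWith (cov t) y) x ≤ η * (g t).scalarCurvatureWith (cov t) x ^ 3 + C := by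
  intro M _ _ _ _ _ _ g cov T m K τ hT hm hK hτ0 hτ1 hflow hRiem hpinch hVs hNs hevol η hη
  have hsub : ∀ {T' : ℝ}, T' < T → Icc 0 T' ⊆ Ico 0 T := fun hT' s hs ↦ ⟨hs.1, hs.2.trans_lt hT'⟩
  exact gradientBound_core (g := g) (R := fun s y ↦ (g s).scalarCurvatureWith (cov s) y)
    (V := fun s y ↦ (g s).gradSq (fun z ↦ (g s).scalarCurvatureWith (cov s) z) y)
    (N := fun s y ↦ (g s).normSq y ((cov s).ricci y)) (Q := fun s y ↦ (g s).curvNormSqWith (cov s) y)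
    hT hm hK hτ0 hτ1 hRiem (fun t ht x ↦ roundness_dictionary hflow hRiem hpinch ht x)
    (fun t ht x ↦ gradientBound_gradSq_nonneg (hRiem t ht) _ x)
    (fun T' _ hT'T ↦ (hflow.mono (hsub hT'T)).contMDiffOn_scalarCurvatureWith) hVs hNs hevol hη

end Literature.Geometry.Riemannian.HamiltonPinchedFlow

end Part8

/-!
## Part 9 — port of `Summits/SmoothPoincare4/SmoothPoincare4/Theorems/EntropyRungChangGurskyYangStubGradientEstimatesDecay.lean` (7 declarations kept)

# Decay of `|∇R|²` under the Type-I sandwich (Hamilton 1982, §17, Lemma 17.4)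

Declarations of this Part (verbatim port; each keeps its own docstring and citation): `rpow_two_sub_le_of_le`, `tracefree_le_mul_sq`, `reaction_bound`, `decay_comparison`, `contDiffOn_decayODE`, `gradSq_le_of_window`, `helper_gradientDecay_of_evolution`.

References: R. S. Hamilton, *Three-manifolds with positive Ricci curvature*, J. Differential Geom. 17 (1982) 255–306 [Hamilton1982]; P. Topping, *Lectures on the Ricci flow*, LMS Lecture Note Series 325, CUP 2006 [Topping2006].
-/

section Part9

open _root_.Set _root_.Function _root_.Filter
open scoped _root_.Manifold _root_.ContDiff _root_.Topology

namespace Literature.Geometry.Riemannian.HamiltonPinchedFlow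

open Literature.Geometry.Riemannian
open Literature.Geometry.Lorentzian Literature.Geometry.Lorentzian.PseudoRiemannianMetric

/-! ### Real-variable lemmas: the reaction term and the comparison ODE -/

section RealLemmas

/-- `R^{2−τ} ≤ m^{−τ} R²` for `R ≥ m > 0`, `τ ≥ 0`. [cite: Hamilton1982, §17, Lemma 17.4] -/
theorem rpow_two_sub_le_of_le {m R τ : ℝ} (hm : 0 < m) (hmR : m ≤ R) (hτ : 0 ≤ τ) :
    R ^ (2 - τ) ≤ m ^ (-τ) * R ^ 2 := by
  have hR0 : 0 < R := hm.trans_le hmR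
  rw [Real.rpow_sub hR0, Real.rpow_two, div_eq_mul_inv, ← Real.rpow_neg hR0.le, mul_comm]
  exact mul_le_mul_of_nonneg_right (Real.rpow_le_rpow_of_nonpos hm hmR (by linarith))
    (sq_nonneg _)

/-- The pinching `|W|² + 2|E|² ≤ K R^{2−τ}`, `|W|² ≥ 0`, `R ≥ m > 0` gives `|E|² ≤ Λ R²` with
`Λ = K m^{−τ}/2` (Hamilton 1982, §17, proof of Lemma 17.4: `|E|²/R² → 0`).
[cite: Hamilton1982, §17, Lemma 17.4] -/
theorem tracefree_le_mul_sq {K m τ R E₂ W₂ : ℝ} (hm : 0 < m) (hK : 0 ≤ K) (hτ : 0 ≤ τ)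
    (hmR : m ≤ R) (hW : 0 ≤ W₂) (hp : W₂ + 2 * E₂ ≤ K * R ^ (2 - τ)) :
    E₂ ≤ K * m ^ (-τ) / 2 * R ^ 2 := by
  have := mul_le_mul_of_nonneg_left (rpow_two_sub_le_of_le hm hmR hτ) hK
  linarith

/-- **The reaction term of Hamilton's `F`** (Hamilton 1982, §17, proof of Lemma 17.4, with §11,
Thm. 11.1): with `F = V/R + N|E|²`, `N = 180(1+Λ)`, `|E|² = |Ric|² − R²/4 ≥ 0`, `V = |∇R|² ≥ 0`,
`|W|² = |Rm|² − 2|Ric|² + R²/3 ≥ 0`, `|W|² + 2|E|² ≤ K R^{2−τ}`, `R ≥ m > 0` and the sandwich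
`c₁ ≤ dR ≤ c₂` (`d = T − t > 0`), the reaction term satisfies
`−V + N(64|Rm| + R)|E|² ≤ −(c₁/d) F + C₃ d^{τ−3}` for a constant `C₃ = C₃(K, m, τ, Λ, c₂) ≥ 0`:
`−V = −RF + NR|E|² ≤ −(c₁/d)F + NR|E|²`, `|Rm| ≤ (Km^{−τ} + 1/6)^{1/2} R`,
`|E|² ≤ (K/2)R^{2−τ}`, `R^{3−τ} ≤ c₂^{3−τ} d^{τ−3}`. [cite: Hamilton1982, §17, Lemma 17.4] -/
theorem reaction_bound {K m τ Λ c₁ : ℝ} (c₂ : ℝ) (hm : 0 < m) (hK : 0 < K) (hτ0 : 0 < τ)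
    (hτ1 : τ ≤ 1) (hΛ : 0 ≤ Λ) (hc₁ : 0 < c₁) :
    ∃ C₃ : ℝ, 0 ≤ C₃ ∧ ∀ R V P Q d : ℝ, m ≤ R → 0 ≤ V → 0 ≤ P - R ^ 2 / 4 →
      0 ≤ Q - 2 * P + R ^ 2 / 3 → (Q - 2 * P + R ^ 2 / 3) + 2 * (P - R ^ 2 / 4) ≤ K * R ^ (2 - τ) →
      0 < d → c₁ ≤ d * R → d * R ≤ c₂ →
      -V + 180 * (1 + Λ) * (64 * Real.sqrt Q + R) * (P - R ^ 2 / 4) ≤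
        -(c₁ / d) * (V / R + 180 * (1 + Λ) * (P - R ^ 2 / 4)) + C₃ * d ^ (τ - 3) := by
  set A : ℝ := K * m ^ (-τ) + 1 / 6 with hA
  have hA0 : 0 ≤ A := by positivity
  set cQ : ℝ := Real.sqrt A with hcQ
  have hcQ0 : 0 ≤ cQ := Real.sqrt_nonneg _
  set Nc : ℝ := 180 * (1 + Λ) with hNc
  have hNc0 : 0 ≤ Nc := by positivity
  set C₂ : ℝ := Nc * (64 * cQ + 2) * (K / 2) with hC₂
  have hC₂0 : 0 ≤ C₂ := by positivity
  refine ⟨C₂ * |c₂| ^ (3 - τ), by positivity, ?_⟩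
  intro R V P Q d hmR hV hE hW hp hd hc₁R hRc₂
  have hR0 : 0 < R := hm.trans_le hmR
  have hc₂0 : 0 < c₂ := by linarith
  set E₂ : ℝ := P - R ^ 2 / 4 with hE₂
  -- `F ≥ 0` and `R ≥ c₁ / d`
  have hu0 : 0 ≤ V / R + Nc * E₂ := add_nonneg (div_nonneg hV hR0.le) (mul_nonneg hNc0 hE)
  have hcR : c₁ / d ≤ R := by rw [div_le_iff₀ hd]; linarith
  have h2 : -R * (V / R + Nc * E₂) ≤ -(c₁ / d) * (V / R + Nc * E₂) :=
    mul_le_mul_of_nonneg_right (neg_le_neg hcR) hu0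
  -- `|Rm| ≤ cQ R` and `|E|² ≤ (K/2) R^{2-τ}`
  have hrpow : R ^ (2 - τ) ≤ m ^ (-τ) * R ^ 2 := rpow_two_sub_le_of_le hm hmR hτ0.le
  have hQ : Q ≤ A * R ^ 2 := by
    have : K * R ^ (2 - τ) ≤ K * (m ^ (-τ) * R ^ 2) := mul_le_mul_of_nonneg_left hrpow hK.le
    rw [hA]
    linarith
  have hS : Real.sqrt Q ≤ cQ * R := by
    calc Real.sqrt Q ≤ Real.sqrt (A * R ^ 2) := Real.sqrt_le_sqrt hQ
      _ = cQ * R := by rw [Real.sqrt_mul hA0, Real.sqrt_sq hR0.le]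
  have hEle : E₂ ≤ K / 2 * R ^ (2 - τ) := by linarith
  -- the algebra
  have h1 : -V + Nc * (64 * Real.sqrt Q + R) * E₂ =
      -R * (V / R + Nc * E₂) + Nc * (64 * Real.sqrt Q + 2 * R) * E₂ := by
    field_simp
    ring
  have h3 : Nc * (64 * Real.sqrt Q + 2 * R) * E₂ ≤ Nc * ((64 * cQ + 2) * R) * E₂ := by
    have := mul_le_mul_of_nonneg_left hS (mul_nonneg hNc0 hE)
    linarith
  have h4 : Nc * ((64 * cQ + 2) * R) * E₂ ≤ Nc * ((64 * cQ + 2) * R) * (K / 2 * R ^ (2 - τ)) :=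
    mul_le_mul_of_nonneg_left hEle (by positivity)
  have h5 : R * R ^ (2 - τ) = R ^ (3 - τ) := by
    rw [show (3 : ℝ) - τ = 1 + (2 - τ) by ring, Real.rpow_add hR0, Real.rpow_one]
  have h6 : R ^ (3 - τ) ≤ |c₂| ^ (3 - τ) * d ^ (τ - 3) := by
    have hRle : R ≤ c₂ / d := by rw [le_div_iff₀ hd]; linarith
    calc R ^ (3 - τ) ≤ (c₂ / d) ^ (3 - τ) := Real.rpow_le_rpow hR0.le hRle (by linarith)
      _ = |c₂| ^ (3 - τ) * d ^ (τ - 3) := by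
        rw [abs_of_pos hc₂0, Real.div_rpow hc₂0.le hd.le, div_eq_mul_inv,
          ← Real.rpow_neg hd.le, neg_sub]
  have h7 : C₂ * R ^ (3 - τ) ≤ C₂ * (|c₂| ^ (3 - τ) * d ^ (τ - 3)) :=
    mul_le_mul_of_nonneg_left h6 hC₂0
  have h8 : Nc * ((64 * cQ + 2) * R) * (K / 2 * R ^ (2 - τ)) = C₂ * R ^ (3 - τ) := by
    rw [hC₂, ← h5]; ring
  calc -V + Nc * (64 * Real.sqrt Q + R) * E₂
      = -R * (V / R + Nc * E₂) + Nc * (64 * Real.sqrt Q + 2 * R) * E₂ := h1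
    _ ≤ -(c₁ / d) * (V / R + Nc * E₂) + C₂ * R ^ (3 - τ) := by linarith
    _ ≤ -(c₁ / d) * (V / R + Nc * E₂) + C₂ * |c₂| ^ (3 - τ) * d ^ (τ - 3) := by
      rw [mul_assoc]; linarith

/-- **The comparison ODE of Lemma 17.4**: `φ' = −(c₁/(T'−s))φ + C₃(T'−s)^{τ−3}` on `[0, T')` is
solved by `φ(s) = A(T'−s)^{τ−2} + B(T'−s)^{c₁}`, `A = C₃/(2−τ+c₁)`, with any prescribed
`φ(0) = α`, and `φ(s) ≤ C₄ (T'−s)^{τ−2}` (`τ ≤ 1 < 2`, `c₁ > 0`).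
[cite: Hamilton1982, §17, Lemma 17.4] -/
theorem decay_comparison {T' c₁ τ C₃ : ℝ} (hT' : 0 < T') (hc₁ : 0 < c₁) (hτ1 : τ ≤ 1)
    (hC₃ : 0 ≤ C₃) (α : ℝ) :
    ∃ φ : ℝ → ℝ, ∃ C₄ : ℝ, φ 0 = α ∧ 0 ≤ C₄ ∧
      (∀ s < T', HasDerivAt φ (-(c₁ / (T' - s)) * φ s + C₃ * (T' - s) ^ (τ - 3)) s) ∧
      (∀ s, 0 ≤ s → s < T' → φ s ≤ C₄ * (T' - s) ^ (τ - 2)) := by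
  have hden : 0 < 2 - τ + c₁ := by linarith
  set A : ℝ := C₃ / (2 - τ + c₁) with hA
  have hA0 : 0 ≤ A := div_nonneg hC₃ hden.le
  have hAC : A * (2 - τ + c₁) = C₃ := div_mul_cancel₀ C₃ hden.ne'
  have hP1 : 0 < T' ^ c₁ := Real.rpow_pos_of_pos hT' _
  set B : ℝ := (α - A * T' ^ (τ - 2)) / T' ^ c₁ with hB
  refine ⟨fun s ↦ A * (T' - s) ^ (τ - 2) + B * (T' - s) ^ c₁, A + |B| * T' ^ c₁ * T' ^ (2 - τ),
    ?_, add_nonneg hA0 (by positivity), ?_, ?_⟩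
  · simp only [sub_zero]
    rw [hB, div_mul_cancel₀ _ hP1.ne']
    ring
  · intro s hs
    have hd : 0 < T' - s := sub_pos.2 hs
    have hlin : HasDerivAt (fun r : ℝ ↦ T' - r) (-1) s := by
      simpa using (hasDerivAt_id s).const_sub T'
    have h1 := (hlin.rpow_const (p := τ - 2) (Or.inl hd.ne')).const_mul A
    have h2 := (hlin.rpow_const (p := c₁) (Or.inl hd.ne')).const_mul B
    refine (h1.add h2).congr_deriv ?_
    rw [Real.rpow_sub_one hd.ne' (τ - 2), Real.rpow_sub_one hd.ne' c₁,
      show τ - 3 = τ - 2 - 1 by ring, Real.rpow_sub_one hd.ne' (τ - 2), ← hAC]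
    field_simp
    ring
  · intro s hs0 hs
    have hd : 0 < T' - s := sub_pos.2 hs
    have hdT : T' - s ≤ T' := by linarith
    have hY0 : 0 ≤ (T' - s) ^ c₁ := Real.rpow_nonneg hd.le _
    have hY : (T' - s) ^ c₁ ≤ T' ^ c₁ := Real.rpow_le_rpow hd.le hdT hc₁.le
    have hX : T' ^ (τ - 2) ≤ (T' - s) ^ (τ - 2) :=
      Real.rpow_le_rpow_of_nonpos hd hdT (by linarith)
    have hone : T' ^ (2 - τ) * T' ^ (τ - 2) = 1 := by
      rw [← Real.rpow_add hT', show 2 - τ + (τ - 2) = 0 by ring, Real.rpow_zero]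
    have hBY : B * (T' - s) ^ c₁ ≤ |B| * (T' - s) ^ c₁ :=
      mul_le_mul_of_nonneg_right (le_abs_self B) hY0
    have h2 : |B| * (T' - s) ^ c₁ ≤ |B| * T' ^ c₁ := mul_le_mul_of_nonneg_left hY (abs_nonneg B)
    have h4 : |B| * T' ^ c₁ = |B| * T' ^ c₁ * T' ^ (2 - τ) * T' ^ (τ - 2) := by
      rw [mul_assoc (|B| * T' ^ c₁), hone, mul_one]
    have h3 : |B| * T' ^ c₁ * T' ^ (2 - τ) * T' ^ (τ - 2) ≤
        |B| * T' ^ c₁ * T' ^ (2 - τ) * (T' - s) ^ (τ - 2) :=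
      mul_le_mul_of_nonneg_left hX (by positivity)
    show A * (T' - s) ^ (τ - 2) + B * (T' - s) ^ c₁ ≤
      (A + |B| * T' ^ c₁ * T' ^ (2 - τ)) * (T' - s) ^ (τ - 2)
    linarith

/-- The right-hand side `F_ode(r, s) = −(c₁/(T'−s)) r + C₃ (T'−s)^{τ−3}` of the comparison ODE is
`C¹` on `ℝ × [0, w]` for `w < T'`. [cite: Hamilton1982, §17, Lemma 17.4] -/
theorem contDiffOn_decayODE {T' c₁ C₃ τ w : ℝ} (hw : w < T') :
    ContDiffOn ℝ 1 (uncurry fun (r s : ℝ) ↦ -(c₁ / (T' - s)) * r + C₃ * (T' - s) ^ (τ - 3))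
      (univ ×ˢ Icc 0 w) := by
  intro p hp
  have hne : T' - p.2 ≠ 0 := by
    have := hp.2.2
    exact (sub_pos.2 (this.trans_lt hw)).ne'
  have hd : ContDiffAt ℝ 1 (fun q : ℝ × ℝ ↦ T' - q.2) p := contDiffAt_const.sub contDiffAt_snd
  have h : ContDiffAt ℝ 1
      (fun q : ℝ × ℝ ↦ -(c₁ / (T' - q.2)) * q.1 + C₃ * (T' - q.2) ^ (τ - 3)) p :=
    (((contDiffAt_const.div hd hne).neg).mul contDiffAt_fst).add
      (contDiffAt_const.mul (hd.rpow_const_of_ne hne))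
  exact h.contDiffWithinAt

/-- From `F = V/R + N|E|² ≤ C₄ d^{τ−2}` and `dR ≤ c₂`: `V ≤ RF ≤ c₂ C₄ d^{τ−3}`
(Hamilton 1982, §17, last line of the proof of Lemma 17.4). [cite: Hamilton1982, §17, Lemma 17.4] -/
theorem gradSq_le_of_window {R V E₂ Nc C₄ c₂ d τ : ℝ} (hR : 0 < R) (hd : 0 < d)
    (hRc : d * R ≤ c₂) (hE : 0 ≤ E₂) (hNc : 0 ≤ Nc) (hC₄ : 0 ≤ C₄)
    (hF : V / R + Nc * E₂ ≤ C₄ * d ^ (τ - 2)) : V ≤ c₂ * C₄ * d ^ (τ - 3) := by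
  have hX : 0 < d ^ (τ - 2) := Real.rpow_pos_of_pos hd _
  have h1 : V ≤ C₄ * d ^ (τ - 2) * R := by
    rw [← div_le_iff₀ hR]
    linarith [mul_nonneg hNc hE]
  have h2 : C₄ * d ^ (τ - 2) * R ≤ C₄ * d ^ (τ - 2) * (c₂ / d) :=
    mul_le_mul_of_nonneg_left (by rw [le_div_iff₀ hd]; linarith) (by positivity)
  have h3 : d ^ (τ - 3) = d ^ (τ - 2) / d := by
    rw [show τ - 3 = τ - 2 - 1 by ring, Real.rpow_sub_one hd.ne']
  rw [h3]
  calc V ≤ C₄ * d ^ (τ - 2) * (c₂ / d) := h1.trans h2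
    _ = c₂ * C₄ * (d ^ (τ - 2) / d) := by ring

end RealLemmas

/-! ### The endgame of Lemma 17.4 -/

/-- **HELPER H4 — Hamilton 1982, Lemma 17.4 (decay of `|∇R|` under the Type-I sandwich), the
weak-maximum-principle endgame.** Along a Ricci flow on `[0, T)` on a closed 4-manifold with the
invariant pinching `m ≤ R`, `|W|² + 2|E|² ≤ K R^{2−τ}` (`0 < τ ≤ 1`), GIVEN the space-time
regularity of `R`, `|∇R|²`, `|Ric|²` along every restarted flow `s ↦ g(s + t₁)` on `M × [0, w]`
and Hamilton's evolution inequality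
`∂ₛF ≤ ΔF − |∇R|² + 180(1+Λ)(64|Rm| + R)|E|²` for `F = |∇R|²/R + 180(1+Λ)|E|²` wherever
`|E|² ≤ ΛR²`: if `c₁ ≤ (T−t)R ≤ c₂` on `[t₁, T)` (`c₁ > 0`), then
`|∇R|² ≤ C (T−t)^{δ−3}` on `[t₁, T)` with `δ = τ > 0`. Proof: module docstring
(`tracefree_le_mul_sq`, `reaction_bound`, `weakMaximumPrinciple` with `decay_comparison` and
`contDiffOn_decayODE`, `gradSq_le_of_window`). [cite: Hamilton1982, §17, Lemma 17.4] -/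
theorem helper_gradientDecay_of_evolution : ∀ (M : Type) [TopologicalSpace M] [T2Space M] [SecondCountableTopology M] [ChartedSpace (EuclideanSpace ℝ (Fin 4)) M] [IsManifold (𝓡 4) ∞ M] [CompactSpace M] (g : ℝ → PseudoRiemannianMetric (𝓡 4) ∞ (EuclideanSpace ℝ (Fin 4)) (TangentSpace (𝓡 4) : M → Type _)) (cov : ℝ → CovariantDerivative (𝓡 4) (EuclideanSpace ℝ (Fin 4)) (TangentSpace (𝓡 4) : M → Type _)) (T m K τ : ℝ), 0 < T → 0 < m → 0 < K → 0 < τ → τ ≤ 1 → IsRicciFlow g cov (Ico 0 T) → (∀ t ∈ Ico 0 T, (g t).IsRiemannian) → (∀ t ∈ Ico 0 T, ∀ [(g t).HasLeviCivita] (x : M), m ≤ (g t).scalarCurvature x ∧ (g t).weylNormSq x + 2 * (g t).tracelessRicciNormSq x ≤ K * (g t).scalarCurvature x ^ (2 - τ)) → (∀ t₁ w : ℝ, 0 ≤ t₁ → 0 < w → t₁ + w < T → ContMDiffOn ((𝓡 4).prod 𝓘(ℝ, ℝ)) 𝓘(ℝ, ℝ) ∞ (fun p : M × ℝ ↦ (g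 (p.2 + t₁)).scalarCurvatureWith (cov (p.2 + t₁)) p.1) (univ ×ˢ Icc 0 w)) → (∀ t₁ w : ℝ, 0 ≤ t₁ → 0 < w → t₁ + w < T → ContMDiffOn ((𝓡 4).prod 𝓘(ℝ, ℝ)) 𝓘(ℝ, ℝ) ∞ (fun p : M × ℝ ↦ (g (p.2 + t₁)).gradSq (fun y ↦ (g (p.2 + t₁)).scalarCurvatureWith (cov (p.2 + t₁)) y) p.1) (univ ×ˢ Icc 0 w)) → (∀ t₁ w : ℝ, 0 ≤ t₁ → 0 < w → t₁ + w < T → ContMDiffOn ((𝓡 4).prod 𝓘(ℝ, ℝ)) 𝓘(ℝ, ℝ) ∞ (fun p : M × ℝ ↦ (g (p.2 + t₁)).normSq p.1 ((cov (p.2 + t₁)).ricci p.1)) (univ ×ˢ Icc 0 w)) → (∀ (Λ t₁ w : ℝ), 0 ≤ Λ → 0 ≤ t₁ → 0 < w → t₁ + w < T → ∀ s ∈ Icc 0 w, ∀ x : M, (g (s + t₁)).normSq x ((cov (s + t₁)).ricci x) - (g (s + t₁)).scalarCurvatureWith (cov (s + t₁)) x ^ 2 / 4 ≤ Λ * (g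 (s + t₁)).scalarCurvatureWith (cov (s + t₁)) x ^ 2 → derivWithin (fun r ↦ (g (r + t₁)).gradSq (fun y ↦ (g (r + t₁)).scalarCurvatureWith (cov (r + t₁)) y) x / (g (r + t₁)).scalarCurvatureWith (cov (r + t₁)) x + 180 * (1 + Λ) * ((g (r + t₁)).normSq x ((cov (r + t₁)).ricci x) - (g (r + t₁)).scalarCurvatureWith (cov (r + t₁)) x ^ 2 / 4)) (Icc 0 w) s ≤ (g (s + t₁)).laplaceBeltrami (fun y ↦ (g (s + t₁)).gradSq (fun z ↦ (g (s + t₁)).scalarCurvatureWith (cov (s + t₁)) z) y / (g (s + t₁)).scalarCurvatureWith (cov (s + t₁)) y + 180 * (1 + Λ) * ((g (s + t₁)).normSq y ((cov (s + t₁)).ricci y) - (g (s + t₁)).scalarCurvatureWith (cov (s + t₁)) y ^ 2 / 4)) x + (-(g (s + t₁)).gradSq (fun y ↦ (g (s + t₁)).scalarCurvatureWith (cov (s + t₁)) y) x + 180 * (1 + Λ) * (64 * Real.sqrt ((g (s + t₁)).curvNormSqWith (cov (s + t₁)) x) + (g (s + t₁)).scalarCurvatureWith (cov (s + t₁)) x)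 * ((g (s + t₁)).normSq x ((cov (s + t₁)).ricci x) - (g (s + t₁)).scalarCurvatureWith (cov (s + t₁)) x ^ 2 / 4))) → ∀ (t₁ c₁ c₂ : ℝ), t₁ ∈ Ico 0 T → 0 < c₁ → (∀ t ∈ Ico t₁ T, ∀ x : M, c₁ ≤ (T - t) * (g t).scalarCurvatureWith (cov t) x ∧ (T - t) * (g t).scalarCurvatureWith (cov t) x ≤ c₂) → ∃ δ C : ℝ, 0 < δ ∧ ∀ t ∈ Ico t₁ T, ∀ x : M, (g t).gradSq (fun y ↦ (g t).scalarCurvatureWith (cov t) y) x ≤ C * (T - t) ^ (δ - 3) := by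
  intro M _ _ _ _ _ _ g cov T m K τ hT hm hK hτ0 hτ1 hflow hRiem hpinch hRreg hVreg hNreg hev t₁ c₁
    c₂ ht₁ hc₁ hsand
  -- the pinching dictionary along the flow and `|E|² ≤ Λ R²`
  have hdict := fun {t : ℝ} (ht : t ∈ Ico 0 T) (x : M) ↦
    roundness_dictionary hflow hRiem hpinch ht x
  obtain ⟨Λ, hΛ0, hΛE⟩ : ∃ Λ : ℝ, 0 ≤ Λ ∧ ∀ t ∈ Ico 0 T, ∀ x : M,
      (g t).normSq x ((cov t).ricci x) - (g t).scalarCurvatureWith (cov t) x ^ 2 / 4 ≤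
        Λ * (g t).scalarCurvatureWith (cov t) x ^ 2 := by
    refine ⟨K * m ^ (-τ) / 2, by positivity, fun t ht x ↦ ?_⟩
    obtain ⟨hmR, -, hW, hp⟩ := hdict ht x
    exact tracefree_le_mul_sq hm hK.le hτ0.le hmR hW hp
  -- the reaction constant
  obtain ⟨C₃, hC₃0, hreact⟩ := reaction_bound c₂ hm hK hτ0 hτ1 hΛ0 hc₁
  -- Hamilton's function along the flow restarted at `t₁`
  obtain ⟨u, hu⟩ : ∃ u : ℝ → M → ℝ, u = fun s y ↦
      (g (s + t₁)).gradSq (fun z ↦ (g (s + t₁)).scalarCurvatureWith (cov (s + t₁)) z) y /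
          (g (s + t₁)).scalarCurvatureWith (cov (s + t₁)) y +
        180 * (1 + Λ) * ((g (s + t₁)).normSq y ((cov (s + t₁)).ricci y) -
          (g (s + t₁)).scalarCurvatureWith (cov (s + t₁)) y ^ 2 / 4) := ⟨_, rfl⟩
  -- its regularity on every window `M × [0, w]`
  have hureg : ∀ w : ℝ, 0 < w → t₁ + w < T →
      ContMDiffOn ((𝓡 4).prod 𝓘(ℝ, ℝ)) 𝓘(ℝ, ℝ) ∞ (fun p : M × ℝ ↦ u p.2 p.1) (univ ×ˢ Icc 0 w) := by
    intro w hw hwT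
    have HR := hRreg t₁ w ht₁.1 hw hwT
    have HV := hVreg t₁ w ht₁.1 hw hwT
    have HN := hNreg t₁ w ht₁.1 hw hwT
    have hne : ∀ p ∈ univ ×ˢ Icc (0 : ℝ) w,
        (g ((p : M × ℝ).2 + t₁)).scalarCurvatureWith (cov (p.2 + t₁)) p.1 ≠ 0 := by
      intro p hp
      have hmem : p.2 + t₁ ∈ Ico 0 T := ⟨by linarith [hp.2.1, ht₁.1], by linarith [hp.2.2]⟩
      exact (hm.trans_le (hdict hmem p.1).1).ne'
    rw [hu]
    exact (HV.div₀ HR hne).add (contMDiffOn_const.mul (HN.sub ((HR.pow 2).div_const 4)))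
  -- the initial bound `α`
  have hT' : 0 < T - t₁ := sub_pos.2 ht₁.2
  have hw₀ : 0 < (T - t₁) / 2 := by positivity
  have hw₀T : t₁ + (T - t₁) / 2 < T := by linarith
  have hcont : Continuous (u 0) :=
    (contMDiff_slice (hureg _ hw₀ hw₀T) (t := 0) ⟨le_rfl, hw₀.le⟩).continuous
  obtain ⟨α, hα⟩ := (isCompact_range hcont).bddAbove
  have hu0 : ∀ x : M, u 0 x ≤ α := fun x ↦ hα (mem_range_self x)
  -- the comparison function and the right-hand side of the ODE
  obtain ⟨φ, C₄, hφ0, hC₄0, hφd, hφle⟩ := decay_comparison hT' hc₁ hτ1 hC₃0 α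
  obtain ⟨Fo, hFo⟩ : ∃ Fo : ℝ → ℝ → ℝ,
      Fo = fun r s ↦ -(c₁ / (T - t₁ - s)) * r + C₃ * (T - t₁ - s) ^ (τ - 3) := ⟨_, rfl⟩
  -- KEY: `F(t, x) ≤ C₄ (T - t)^{τ-2}` on `[t₁, T)`
  have hFle : ∀ t ∈ Ico t₁ T, ∀ x : M, u (t - t₁) x ≤ C₄ * (T - t) ^ (τ - 2) := by
    intro t ht x
    rcases ht.1.eq_or_lt with heq | hlt
    · subst heq
      rw [sub_self]
      calc u 0 x ≤ α := hu0 x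
        _ = φ 0 := hφ0.symm
        _ ≤ C₄ * (T - t₁ - 0) ^ (τ - 2) := hφle 0 le_rfl hT'
        _ = C₄ * (T - t₁) ^ (τ - 2) := by rw [sub_zero]
    -- the weak maximum principle on the window `[0, t - t₁]` for the restarted flow
    have hw0 : 0 < t - t₁ := sub_pos.2 hlt
    have hwT : t₁ + (t - t₁) < T := by linarith [ht.2]
    have hwT' : t - t₁ < T - t₁ := by linarith [ht.2]
    have hmem : ∀ s ∈ Icc 0 (t - t₁), s + t₁ ∈ Ico t₁ T ∧ s + t₁ ∈ Ico 0 T := fun s hs ↦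
      ⟨⟨by linarith [hs.1], by linarith [hs.2]⟩, ⟨by linarith [hs.1, ht₁.1], by linarith [hs.2]⟩⟩
    have hR' : ∀ s ∈ Icc 0 (t - t₁), (g (s + t₁)).IsRiemannian := fun s hs ↦
      hRiem _ (hmem s hs).2
    have hFo' : ContDiffOn ℝ 1 (uncurry Fo) (univ ×ˢ Icc 0 (t - t₁)) := by
      rw [hFo]
      exact contDiffOn_decayODE hwT'
    have hφw : ∀ s ∈ Icc 0 (t - t₁), HasDerivWithinAt φ (Fo (φ s) s) (Icc 0 (t - t₁)) s := by
      intro s hs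
      rw [hFo]
      exact (hφd s (hs.2.trans_lt hwT')).hasDerivWithinAt
    have hineq : ∀ s ∈ Icc 0 (t - t₁), ∀ y : M,
        derivWithin (fun r ↦ u r y) (Icc 0 (t - t₁)) s ≤
          (g (s + t₁)).laplaceBeltrami (u s) y +
            mvfderiv (𝓡 4) (u s) y ((fun (_ : ℝ) (z : M) ↦ (0 : TangentSpace (𝓡 4) z)) s y) +
            Fo (u s y) s := by
      intro s hs y
      obtain ⟨hst, hst'⟩ := hmem s hs
      obtain ⟨hmR, hE, hW, hp⟩ := hdict hst' y
      have hV0 := (g (s + t₁)).gradSq_nonneg (hRiem _ hst')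
        (fun z ↦ (g (s + t₁)).scalarCurvatureWith (cov (s + t₁)) z) y
      have hsd := hsand (s + t₁) hst y
      have hTs : T - (s + t₁) = T - t₁ - s := by ring
      rw [hTs] at hsd
      have hd : 0 < T - t₁ - s := by linarith [hs.2]
      have h1 := hev Λ t₁ (t - t₁) hΛ0 ht₁.1 hw0 hwT s hs y (hΛE _ hst' y)
      have h2 := hreact _ _ _ _ _ hmR hV0 hE hW hp hd hsd.1 hsd.2
      simp only [hu, hFo, map_zero, add_zero]
      linarith
    have key := weakMaximumPrinciple hw0 hR' (fun (_ : ℝ) (z : M) ↦ (0 : TangentSpace (𝓡 4) z))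
      hFo' (hureg _ hw0 hwT) hineq hφw hφ0 hu0 (t - t₁) ⟨hw0.le, le_rfl⟩ x
    have hTt : T - t₁ - (t - t₁) = T - t := by ring
    calc u (t - t₁) x ≤ φ (t - t₁) := key
      _ ≤ C₄ * (T - t₁ - (t - t₁)) ^ (τ - 2) := hφle _ hw0.le hwT'
      _ = C₄ * (T - t) ^ (τ - 2) := by rw [hTt]
  -- conclusion: `|∇R|² ≤ R F ≤ c₂ C₄ (T - t)^{τ-3}`
  refine ⟨τ, c₂ * C₄, hτ0, fun t ht x ↦ ?_⟩
  have ht' : t ∈ Ico 0 T := ⟨ht₁.1.trans ht.1, ht.2⟩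
  obtain ⟨hmR, hE, -, -⟩ := hdict ht' x
  have hF := hFle t ht x
  simp only [hu, sub_add_cancel] at hF
  exact gradSq_le_of_window (hm.trans_le hmR) (sub_pos.2 ht.2) (hsand t ht x).2 hE (by positivity)
    hC₄0 hF

end Literature.Geometry.Riemannian.HamiltonPinchedFlow

end Part9

/-!
## Part 10 — port of `Summits/SmoothPoincare4/SmoothPoincare4/Theorems/EntropyRungChangGurskyYangStubGradientEstimates.lean` (1 declarations kept)

# Hamilton's gradient estimates for the scalar curvature along a pinched Ricci flow (Thm. 11.1 and Lemma 17.4 assembled)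

Declarations of this Part (verbatim port; each keeps its own docstring and citation): `stub_gradientEstimates`.

References: R. S. Hamilton, *Three-manifolds with positive Ricci curvature*, J. Differential Geom. 17 (1982) 255–306 [Hamilton1982]; G. Huisken, *Ricci deformation of the metric on a Riemannian manifold*, J. Differential Geom. 21 (1985) 47–62 [Huisken1985].
-/

section Part10

open _root_.Set _root_.Function _root_.Filter
open scoped _root_.Manifold _root_.ContDiff _root_.Topology

namespace Literature.Geometry.Riemannian.HamiltonPinchedFlow

open Literature.Geometry.Riemannian
open Literature.Geometry.Lorentzian Literature.Geometry.Lorentzian.PseudoRiemannianMetric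

/-- **HAMILTON'S GRADIENT ESTIMATES FOR THE SCALAR CURVATURE (Hamilton 1982,
Thm. 11.1 with Lemmas 11.6–11.9, and Lemma 17.4; Huisken 1985, Thm. 4.1 with Lemma 4.3; dimension 4).**
Along a Ricci flow of Riemannian metrics on `[0, T)` on a closed 4-manifold with the invariant pinching
`m ≤ R`, `|W|² + 2|E|² ≤ K R^{2−τ}`: (i) for every `η > 0` there is `C` with `|∇R|² ≤ η R³ + C` on
`M × [0, T)`; (ii) if moreover `c₁ ≤ (T−t)R ≤ c₂` on `[t₁, T)` with `c₁ > 0`, then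
`|∇R|² ≤ C (T−t)^{δ−3}` there for some `δ > 0`. Assembly of H0–H4: positivity of `R` from the
pinching (`roundness_dictionary`), restriction of the flow to `[0, T']` (`IsRicciFlow.mono`) and
restart at `t₁` (`isRicciFlow_restart`), the `η = 0` instance of H0 for Hamilton's `F` itself.
[cite: Hamilton1982, §11, Thm. 11.1, Lemmas 11.6–11.9; §17, Lemma 17.4] [cite: Huisken1985, §4, Thm. 4.1, Lemma 4.3] -/
theorem stub_gradientEstimates :
    ∀ (M : Type) [TopologicalSpace M] [T2Space M] [SecondCountableTopology M]
      [ChartedSpace (EuclideanSpace ℝ (Fin 4)) M] [IsManifold (𝓡 4) ∞ M] [CompactSpace M]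
      (g : ℝ → PseudoRiemannianMetric (𝓡 4) ∞ (EuclideanSpace ℝ (Fin 4)) (TangentSpace (𝓡 4) : M → Type _))
      (cov : ℝ → CovariantDerivative (𝓡 4) (EuclideanSpace ℝ (Fin 4)) (TangentSpace (𝓡 4) : M → Type _))
      (T m K τ : ℝ), 0 < T → 0 < m → 0 < K → 0 < τ → τ ≤ 1 →
      IsRicciFlow g cov (Ico 0 T) → (∀ t ∈ Ico 0 T, (g t).IsRiemannian) →
      (∀ t ∈ Ico 0 T, ∀ [(g t).HasLeviCivita] (x : M),
        m ≤ (g t).scalarCurvature x ∧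
          (g t).weylNormSq x + 2 * (g t).tracelessRicciNormSq x ≤
            K * (g t).scalarCurvature x ^ (2 - τ)) →
      (∀ η : ℝ, 0 < η → ∃ C : ℝ, ∀ t ∈ Ico 0 T, ∀ x : M,
        (g t).gradSq (fun y ↦ (g t).scalarCurvatureWith (cov t) y) x ≤
          η * (g t).scalarCurvatureWith (cov t) x ^ 3 + C) ∧
      (∀ (t₁ c₁ c₂ : ℝ), t₁ ∈ Ico 0 T → 0 < c₁ →
        (∀ t ∈ Ico t₁ T, ∀ x : M, c₁ ≤ (T - t) * (g t).scalarCurvatureWith (cov t) x ∧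
          (T - t) * (g t).scalarCurvatureWith (cov t) x ≤ c₂) →
        ∃ δ C : ℝ, 0 < δ ∧ ∀ t ∈ Ico t₁ T, ∀ x : M,
          (g t).gradSq (fun y ↦ (g t).scalarCurvatureWith (cov t) y) x ≤ C * (T - t) ^ (δ - 3)) := by
  intro M _ _ _ _ _ _ g cov T m K τ hT hm hK hτ0 hτ1 hflow hRiem hpinch
  -- positivity of `R` along the flow
  have hRpos : ∀ t ∈ Ico 0 T, ∀ y : M, 0 < (g t).scalarCurvatureWith (cov t) y := fun t ht y ↦
    hm.trans_le (roundness_dictionary hflow hRiem hpinch ht y).1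
  -- restriction of the flow to `[0, T']` and restart at `t₁`
  have hsub : ∀ {T' : ℝ}, T' < T → Icc 0 T' ⊆ Ico 0 T := fun hT' s hs ↦ ⟨hs.1, hs.2.trans_lt hT'⟩
  have hres : ∀ {t₁ w : ℝ}, 0 ≤ t₁ → t₁ + w < T →
      IsRicciFlow (fun s ↦ g (s + t₁)) (fun s ↦ cov (s + t₁)) (Icc 0 w) := fun ht₁ hw ↦
    isRicciFlow_restart hflow ht₁ fun s hs ↦ ⟨hs.1, by linarith [hs.2]⟩
  constructor
  · refine helper_gradientBound_of_evolution M g cov T m K τ hT hm hK hτ0 hτ1 hflow hRiem hpinch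
      (fun T' hT' hT'T ↦ helper_hamiltonSmoothGradSq M g cov T' hT' (hflow.mono (hsub hT'T)))
      (fun T' hT' hT'T ↦ helper_hamiltonSmoothRicciNormSq M g cov T' hT' (hflow.mono (hsub hT'T)))
      ?_
    intro Λ η T' hΛ hT' hT'T t ht x hΛx
    exact helper_hamiltonEvolution M g cov T' Λ η hT' hΛ (hflow.mono (hsub hT'T))
      (fun s hs ↦ hRiem s (hsub hT'T hs)) t ht (hRpos t (hsub hT'T ht)) x hΛx
  · refine helper_gradientDecay_of_evolution M g cov T m K τ hT hm hK hτ0 hτ1 hflow hRiem hpinch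
      ?_ ?_ ?_ ?_
    · intro t₁ w ht₁ hw hwT
      exact (hres ht₁ hwT).contMDiffOn_scalarCurvatureWith
    · intro t₁ w ht₁ hw hwT
      exact helper_hamiltonSmoothGradSq M (fun s ↦ g (s + t₁)) (fun s ↦ cov (s + t₁)) w hw (hres ht₁ hwT)
    · intro t₁ w ht₁ hw hwT
      exact helper_hamiltonSmoothRicciNormSq M (fun s ↦ g (s + t₁)) (fun s ↦ cov (s + t₁)) w hw
        (hres ht₁ hwT)
    · intro Λ t₁ w hΛ ht₁ hw hwT s hs x hΛx
      have hmem : ∀ r ∈ Icc 0 w, r + t₁ ∈ Ico 0 T := fun r hr ↦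
        ⟨by linarith [hr.1], by linarith [hr.2]⟩
      have key := helper_hamiltonEvolution M (fun r ↦ g (r + t₁)) (fun r ↦ cov (r + t₁)) w Λ 0 hw hΛ
        (hres ht₁ hwT) (fun r hr ↦ hRiem _ (hmem r hr)) s hs (hRpos _ (hmem s hs)) x hΛx
      simp only [zero_mul, sub_zero, mul_zero, zero_sub, neg_mul, one_mul] at key
      simpa only [neg_mul, one_mul] using key

end Literature.Geometry.Riemannian.HamiltonPinchedFlow

end Part10

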